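import Mathlib
import HarnessLib
import HarnessLib.Audit
import Summits.QuantumFields.Statement

/-!
Route: LangevinControlUV

DORMANT since 2026-09-02T19:38:46Z (reconciler: no traction for 5 d (last activity statement-checked at 2026-08-28T18:56:48Z); parked, not closed — `ledger route dormant route-QuantumFields-LangevinControlUV --off` to reactivate) — unstaffed, not closed; items shared with open routes are served there. `ledger route dormant <id> --off` reactivates.

# Route LangevinControlUV — Fictitious time as RG scale — Boué–Dupuis control of the lattice
Yang–Mills Langevin dynamics as a large-field-free UV engine, typed as femto-universe curvature
bounds in CONTINUOUS intrinsic units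

It suffices to show X = UV ∧ IR ∧ OS in ONE system of continuous intrinsic units (repair C′,
2026-08-16; the four C-items
supersede the typed ∀a/free-Γ items, which stay in the file as support edges). UV is the output of
the card's engine (card
langevin-control-uv, K1–K3) stated convention-free: (UV-a) FemtoCurvatureTwoPointC — there are a
CONTINUOUS unit map a(β)
(lattice spacing in physical units as a function of the coupling: a > 0, a → 0 at β → ∞) and ONE
shape function Γ such that on
every periodic torus L⁴ of physical size L·a(β) ≤ ℓ₀ (femto-universe) the connected
plaquette–plaquette (tr F²–tr F²)
correlations obey two-sided bounds c·Γ(n a(β)) ≤ n⁸·Cov ≤ C·Γ(n a(β)) uniformly in the cutoff (card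
K1: a-uniform two-sided
Boué–Dupuis bounds, differentiated in sources). Continuity is the whole point: it couples every pair
of separations n < n′
along RG chains n′·a(β′) = n·a(β) (`rg_chain_of_continuous`,
Cruxes/FemtoCurvatureTwoPoint/Disproof.lean § Repairs), so ONE Γ
pins a to asymptotic-freedom scaling a_AF·e^{O(1)} and the item is the femto continuum limit WITH
OBSERVABLES; the typed
predecessor FemtoCurvatureTwoPoint is implied by fixed-torus β⁻² semiclassics through a generic STEP
unit map (singleton level
sets: no UV content, compact U(1) passes) and is kept as the necessary fixed-torus edge. (UV-c)
FemtoCurvatureSkewnessC — in the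
SAME units (∃-bundled on purpose: given a continuous package map, SOME continuous package map also
carries the witness) the third
cumulant of the plaquette field is bounded below on femto tori (the lattice-side `IsNonGaussian`
witness). IR =
LatticeGapInUVUnitsC: for every CONTINUOUS package map a, volume-uniform exponential clustering of
all pairs of gauge-invariant
lattice observables at rate c₁·a(β) — the mass gap in the engine's units, imported from the infrared
routes; by the landed
interval pinning (`twoPointPinned_of_continuous`) it is the finite-size-criterion form
"dimensionless curvature amplitude ≥ u_min at
lattice scale ℓ₀/(8a(β)) ⇒ ξ(β) ≤ K/a(β)", and it is VERBATIM what both live infrared lines already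
reduce to one promoted stub each
(`cruxRepaired_of_blockSamplerCertificate` p92432, `cruxRepaired_of_femtoSlab` p99152). OS =
OSLegsAtWeakCouplingC: from UV-a, UV-c
and IR at a continuous a build a scheme in units a with β_k → ∞ and OS data with `IsYangMillsFor`,
non-trivial non-Gaussian
curvature and `HasLatticeMassGap` (compactness licensed by ruling Y2; E1, E0′-IR and the
femto→large-torus decoupling inside; the
pin stub is landed, `stubPin_of_continuous`). With the shared reduction GapToContinuum (=
OneCertifiedCube's item) X gives
`YangMills` by pure logic (deciding theorem `closes`, kernel-checked; folder Sketch.lean `closesC`).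
(UV-b) FemtoPoincare — finite
fictitious time reaches μ_β — is the engine's internal statement: its typed sup-norm-Lipschitz form
was vacuous (proved,
support); the intended Dirichlet-form version lives in layer 2 over `latticeLangevinDynamics`.
Lean: `FemtoCurvatureTwoPointC ∧ FemtoCurvatureSkewnessC ∧ LatticeGapInUVUnitsC ∧
OSLegsAtWeakCouplingC`

## Assembly
Pure logic (`closes`, sorry-free, five hypotheses, every one used): fix G compact simple;
`IsCompactSimpleLieGroup` supplies a
faithful unitary r; FemtoCurvatureTwoPointC at (G, r) is exactly the antecedent of
FemtoCurvatureSkewnessC, which returns ONE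
continuous unit map a carrying the two-point package AND the skewness witness; LatticeGapInUVUnitsC
and OSLegsAtWeakCouplingC
(both stated for every CONTINUOUS a carrying the package) are evaluated at that a;
OSLegsAtWeakCouplingC returns sch (units a,
β_k → ∞), T with `IsYangMillsFor`, non-triviality, non-Gaussianity and `HasLatticeMassGap r sch Δ`;
GapToContinuum upgrades the
latter to `T.HasMassGap Δ`; this is the body of `YangMills` for G. The optional item `Assembly`
records the same chain
(FemtoCurvatureTwoPointC → FemtoCurvatureSkewnessC → LatticeGapInUVUnitsC → OSLegsAtWeakCouplingC →
GapToContinuum → YangMills) and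
its landed proof `langevinControlUV_assembly_proof` is `unfold Assembly; exact closes`.

Rationale: WHY THIS LINE. Barashkov–Gubinelli turn renormalisation into stochastic control: by the Boué–Dupuis
formula −log E[e^(−F(W))] =
inf_v E[F(W+∫v) + ½∫|v|²] (BoueDupuis1998 Thm 3.1, and Thm 4.1 for functionals of strong solutions
of SDEs; BarashkovGubinelli2020
Thm 2, held as arXiv:1805.10814 p. 7) upper bounds come from competitor drifts and lower bounds from
coercivity, with no cluster or
Mayer expansion (BarashkovGubinelli2020 Thm 1 for Φ⁴₃; BarashkovGubinelli2021,
BarashkovGubinelli2023, GubinelliMeyer2024 for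
Girsanov / infinite volume / decay of correlations). The card's dictionary transplants this to
compact gauge groups: the Wiener
functional is the flat 𝔤^E-valued Brownian motion DRIVING the Shen–Zhu–Zhu lattice Langevin dynamics
dU = −∇S_β dt + √2 dB∘U
(ShenZhuZhu2022 §3 eq. (3.3), Lemma 3.2: globally well-posed at every spacing, invariant law exactly
Wilson's measure; tree
`latticeLangevinDynamics`, D1 LANDED), Parisi–Wu fictitious time is the renormalisation scale (mode
k̂ relaxes at t ≍ k̂⁻²; after
t ↦ t/β the dynamics is a √(2/β)-small random perturbation of the Wilson GRADIENT FLOW — the object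
by which finite-volume running
couplings are defined, LuscherWeiszWolff1991, arXiv:1211.3247), the Wick-ordered drift becomes the
one-loop running action, BG's
coercivity is replaced by compactness of G (0 ≤ N − Re tr ≤ 2N: there is no large-field region) plus
transversal coercivity of S at
the flat variety (Hessian = lattice Maxwell operator; kernel band LANDED p94229), and subcriticality
is replaced by asymptotic
freedom's borderline summability Σ_j g_j⁴ < ∞ (GawedzkiKupiainen1985,
BauerschmidtBrydgesSlade2019RG; MarginalFlowLemma PROVED).
THE LEVER, MECHANISM-GRADE (what repair C′ makes the engine answer for, 2026-08-16): the value
function's two-sided bounds for the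
source-perturbed functionals F_λ = λ·n⁸·(P_0^{01}P_{ne₂}^{01})-cumulants must hold with constants
depending on the trajectory ONLY
through Σ_{j ≤ log₂(ℓ₀/(n·a))} g_j⁴ — that is exactly uniformity ALONG RG CHAINS n·a(β) = s (L = 8n
→ ∞ lattice sites at fixed physical
separation s), which `Continuous a` adds (`rg_chain_of_continuous`: every n < n′ is coupled at all
large β to a later β′ with
n′a(β′) = n a(β)) and which the typed item never asked for (`cross_comparable` acts only at
coincident arguments, and a generic step
map makes them never coincide). Upper bound: steer B along the one-loop-improved gradient flow of
the background-field action
(control cost ½∫|v|² = O(Σ g_j⁴)); lower bound: for EVERY drift, F(Φ_T(B+∫v)) + ½∫|v|² ≥ tree value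
− C·Σ g_j⁴ by compactness
(bounded running reward) and Maxwell coercivity transversal to gauge orbits with HORIZONTAL controls
(card K3: vertical noise is
free for gauge-invariant F — Elitzur respected). Test of the repair against the disprover's own
probe: compact U(1) (free Maxwell
+ torons) PASSES the typed item (cdisprove gen-2 verdict: non-abelian-ness not load-bearing) and
FAILS C′ — at fixed physical s the
Gaussian amplitude n⁸Cov_{8n,β_n}(n) ≍ κ/β_n² → 0 along every RG chain, against c·Γ(s) > 0 — so C′
makes dimensional transmutation
(a non-vanishing dimensionless curvature amplitude at fixed physical separation as the cutoff is
removed, i.e. asymptotic freedom)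
load-bearing again. Imported areas: stochastic control / large deviations on Wiener space,
Riemannian stochastic analysis on compact
groups (SZZ, Bakry–Émery), finite-size scaling of asymptotically free theories (step scaling: under
C′ the unit map a is, up to
e^{O(1)}, the inverse of the lattice scale at which the dimensionless amplitude n⁸Cov reaches a
fixed value — a THEOREM-shaped reading
by the landed interval pinning `twoPointPinned_of_continuous`, the convention-free pin the g2
retriage asked for), metastability
theory (BovierEtAl2004) for the engine-internal relaxation statement. What it does that prior lines
do not: Bałaban's phase-cell
programme (Balaban1988Convergent Thm 2 / Cor. 3, held) controls effective ACTIONS and stops at UV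
stability (barrier
UVStabilityNonUniqueness); MagnenRivasseauSeneor1993 construct YM₄ with an infrared cutoff in a
non-gauge-invariant regularisation
without lattice correlation bounds; the continuum SPDE programme stops at d = 3 (barrier
StochasticQuantisationCriticality); here the
dynamics stays on the lattice, the value function IS the generating functional of gauge-invariant
observables, and the deliverable
is typed as RG-consistent two-sided bounds on curvature correlators in continuous intrinsic units
(no β-function coefficient and no
Casimir of a general G appears: a and Γ are existential; continuity + two-sidedness pin them to the
physical scale).

RANKED CRUXES. #2 FemtoCurvatureTwoPointC (crux, TIER-DECIDING; stmt-QuantumFields-16204) — for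
every compact simple G and faithful
unitary r: ∃ CONTINUOUS unit map a (a > 0, a → 0), shape Γ ∈ (0, 1] on (0, ℓ₀], β₀, ℓ₀, c, C > 0
with c·Γ(n a) ≤ n⁸Cov(P_0^{01}, P_{ne₂}^{01})
≤ C·Γ(n a) (1 ≤ n ≤ L/8) and |Cov(P_x^{ij}, P_y^{i′j′})|·dist⁸ ≤ C·Γ(dist·a) on every femto torus
(L·a(β) ≤ ℓ₀, β ≥ β₀) — verbatim
stmt-9363 + `Continuous a ∧`; RG-consistency of the curvature two-point function across femto boxes
(why it might fail: needs
a-UNIFORM two-sided control of a dim-8 composite along every RG chain n·a(β) = s with L = 8n → ∞;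
the BD error Σ_j g_j⁴ ≍ g²(s) is
the size of the signal's own running; artefacts at n ≤ 3 and toron/zero-mode terms at n ≍ L/8 must
stay inside ONE [c, C] for all
β). [BarashkovGubinelli2020, BoueDupuis1998, ShenZhuZhu2022, Balaban1988Convergent,
MagnenRivasseauSeneor1993, Luscher1983,
LuscherWeiszWolff1991, arXiv:1211.3247, CosteEtAl1985] #4 FemtoCurvatureSkewnessC (stmt-16205) —
R1∘C′: if some continuous unit map
carries the femto two-point package at (G, r), then some continuous unit map carries the package AND
n¹²·|κ₃(P_0^{01}, P_{ne₂}^{01},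
P_{ne₃}^{01})| ≥ c₃·Γ₃(n a(β)) > 0 on its femto tori (tree level: triangle 8·dimG·Π⟨F₀₁F₀₁⟩ > 0 at
order g⁶; PerpPropagatorPos p90356,
PermanentalRigidity p88811 landed); ∃-bundled because the typed ∀a shell demanded global κ₃ ≠ 0 at
confinement-scale triangles
(Memo-forall-a-exposure; `closes` needs ONE map) and continuity of the output kills the wild-map
collapse (why it might fail: a
LOWER bound on an odd cumulant needs sign control uniformly along RG chains; remainder and toron
terms O(g⁶L⁻¹²) must not cancel the
tree triangle; for r⊗r ∋ r̄ the strong-coupling sign is −, so ℓ₁ must sit below the flip scale).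
[LuscherWeisz2011, CosteEtAl1985,
Luscher1983, BarashkovGubinelli2020, MagnenRivasseauSeneor1993] #5 LatticeGapInUVUnitsC (stmt-16206)
— IMPORTED infrared leg: for every
CONTINUOUS package map a, ∃ c₁ > 0, β₂, S₁ with |⟨A·τ_nB⟩ − ⟨A⟩⟨B⟩| ≤ C_{AB}·e^{−c₁a(β)n} for all
gauge-invariant local A, B on every torus
of side 2S+1 ≥ 2S₁(β)+1, β ≥ β₂, n ≤ S (`latticeConnectedCorr`) — VERBATIM the disprover's
CruxRepaired and the conclusion of the
LANDED `cruxRepaired_of_blockSamplerCertificate` / `cruxRepaired_of_femtoSlab` (type-ascription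
check, folder Check2.lean rc 0); the
finite-size-criterion form of the Millennium gap, ξ ≍ 1/a two-sidedly (IR-from-below free by RP
log-convexity, TypedDefect9366
§4(F)) (why it might fail: it IS the Millennium gap in UV units — barrier PerturbativeInvisibility;
needs one β-uniform
non-perturbative mixing certificate at cell ⌈K/a(β)⌉ through intermediate volumes with light
torelons; imported, no mechanism
claimed here). [JaffeWitten2000, arXiv180301950,
Literature.MathematicalPhysics.QuantumFieldTheory.LatticeMassGapAllCouplings,
Literature.Barriers.QuantumFields.PerturbativeInvisibility, OsterwalderSeiler1978,
LuscherWeiszWolff1991] #6 OSLegsAtWeakCouplingC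
(stmt-16207) — for every G, r and CONTINUOUS a: two-point package ∧ skewness witness ∧ clustering in
units a ⇒ ∃ sch in units a
(sch.a k = a(sch.β k)) with sch.HasWeakCouplingLimit and OS data T with `IsYangMillsFor r sch T`,
`T.IsNontrivial r.curvature`,
`T.IsNonGaussian r.curvature`, `HasLatticeMassGap r sch Δ`, Δ > 0 (c_curv(k) := a_k⁻⁴; Y2 licence);
the pin stub of line
dlr-collar-transfer is LANDED for continuous a (`stubPin_of_continuous`), so what remains is E1, E0′
at the confinement scale and
the femto → (a_kL_k → ∞) decoupling (why it might fail: hides E1 — barrier RegularisationDichotomy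
—, E0′ for ALL species, and the
decoupling, which Disproof §5 shows is a genuine extra input; compactness gives none of them).
[OsterwalderSchrader1975,
OsterwalderSeiler1978, Seiler1982, GlimmJaffe1987, JaffeWitten2000, DavoudiSavage2012] #9
GapToContinuum (crux, shared verbatim with
OneCertifiedCube, stmt-8896) — `IsYangMillsFor r sch T ∧ HasLatticeMassGap r sch Δ ⇒ T.HasMassGap Δ`
by the reflection-positive
transfer matrix at each k and convergence on ⁰𝒮 (why it might fail: pair-dependent constants in
HasLatticeMassGap vs the uniformity
T.HasMassGap wants; pointwise-only convergence in IsYangMillsFor). [OsterwalderSeiler1978,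
GlimmJaffe1987, Seiler1982] SUPPORT
(superseded typed items, kept as decls because landed Theorems elaborate against their bodies, and
as edges): FemtoCurvatureTwoPoint
stmt-9363 (⟸ FixedTorusTwoSided via the generic-step encoding, landed
…TwoPointEncodingCrux/Reduction*; a NECESSARY sub-goal of #2 by
`PackageWith.esfb`; line generic-step-gamma-encoding has every stub landed except GD-dom ∧ REST-odd
= FixedTorusDiagonalSemiclassics +
the named fact RV), FemtoCurvatureSkewness 9365, LatticeGapInUVUnits 9366, OSLegsAtWeakCoupling
16110, OSLegsFromFemtoAndGap 9367 (each
implies, or is implied by, its C version — Sketch.lean), FemtoPoincare 9364 (closed; vacuous as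
typed), MarginalFlowLemma 9368
(closed), BoueDupuisFemtoValue 9751 (informal engine statement), Assembly (closed; restated to the C
chain).

KILL CRITERIA. FemtoCurvatureTwoPointC refuted for some (G, r) — no CONTINUOUS unit map admits
RG-consistent two-sided cutoff-uniform
bounds — contradicts asymptotic-freedom universality of the curvature two-point function in the
femto universe and closes the route
outright (`close --reason refuted:FemtoCurvatureTwoPointC`); it would be news for every constructive
line. Recorded partial kills
that do NOT close it: faithfulness of r and connectedness of G are load-bearing
(Negative.UnfaithfulFalseSU p110092;
Negative.FiniteGroupFalse p115747 — the ℤ₂/finite variants are FALSE, consistent with exponential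
decay at weak coupling for finite
gauge groups, arXiv:2202.10375, and with barrier ZnHiggsPhaseD4 = DiscreteSubgroupFreezing),
constant or bounded-below Γ is FALSE (ForcedDividend
p73903), the upper-only clause is a THEOREM (UpperOnly p73908): only the lower bound along RG chains
carries content.
FemtoCurvatureSkewnessC refuted (no continuous package map carries a sign-definite κ₃ in femto
boxes) ⇒ pivot, not close: replace
the witness configuration (other planes/separations, smeared tr F²) or take `IsNonGaussian` from an
infrared witness.
LatticeGapInUVUnitsC refuted for some G (ξ(β)a(β) unbounded along every continuous package map) is
the negative side of the summit
for that G and closes every weak-coupling route. OSLegsAtWeakCouplingC refuted ⇒ the decoupling /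
E0′ / E1 legs need an explicit
extra hypothesis (Disproof §5): restate with the decoupling input named, do not close. Mooted: if
ContinuumLimitExists
(OneCertifiedCube, stmt-8894) is proved by another UV engine, #2 and #4 become corollary-grade and
the route is closed `superseded`.

TWO-LAYER PLAN. Foreseen glued splits (none filed; k ≤ 3, depth 1). #2 by REGIME: FixedTorusTwoSided
(n, L fixed, β → ∞ — the typed
item's residue FixedTorusDiagonalSemiclassics, being closed by line generic-step-gamma-encoding;
support-grade necessary edge) →
RGChainTwoSided (two-sided comparability of n⁸Cov_{8n,β_n(s)}(n) along every chain n·a(β_n) = s, n →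
∞, constants from Σ g_j⁴: THE
engine statement, typed over `latticeLangevinDynamics` + `boueDupuisValue` once D2 lands) → glue (a
:= a continuous interpolation of
the step-scaling inverse; Γ read off the chain values). #5 is a socket: its children live in the
infrared routes
(BlockSamplerCertificate S2 / femtoSlab S1 — one β-uniform decoupling certificate at cell ⌈K/a(β)⌉ —
with ALL transport landed:
p81103, p86700, p90222, p80165, p96985, p97393). #6 ⇐ Decoupling (femto short-distance bounds
persist on large tori given #5) →
TreeBoundsIR → E1 (rotation routes).

NOT DECOMPOSED YET. Card K3 (gauge covariance inside the control problem: horizontal controls) and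
P1 (Boué–Dupuis for Stratonovich
SDEs on a compact matrix group through the Itô map; BoueDupuis1998 Thm 4.1, Üstünel/Lehec proofs)
are engine-internal lemmas that
ride with `--supports FemtoCurvatureTwoPointC`; the engine statement BoueDupuisFemtoValue
(stmt-9751) gets its signature once
`boueDupuisValue` lands (D2 open; phrase it over the DEFINITIONS, not over cite-only facts, to keep
the cone clean); the intended
FemtoPoincaré (spectral gap of the SZZ generator ≥ (C L^p)⁻¹ in the deep-femto band, Dirichlet form
Σ_e∫|∇_eF|² on the right) is
layer 2; truncated n-point bounds for n ≥ 4, the asymptotic-freedom dividend as a RATE (Γ(s) ≍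
1/log²(1/s)), rigid ('t Hooft-twisted)
sectors and flowed observables (LuscherWeisz2011, Ramos2013) are deliberately left out; constants
(β₀, ℓ₀, c, C, c₁, …) are
existential everywhere. No `MonotoneOn Γ` clause was added: continuity of a alone closes the
loophole (Disproof § Repairs) and
matches the landed C′ theorems verbatim.

CHEAPEST FALSIFIER. For the repaired deciding crux a fixed-torus computation can no longer falsify
(all consistent: MC
j009165/j013387/j014620, kernel numerics j006894/j013308); the cheap check is an RG-CHAIN test —
SU(2), Wilson action, ONE kit job
(KP heat bath; multilevel for n = 3): couplings matched by two-loop a(β) (β_Wave0 = 2/g₀²; L = 16 at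
β and L = 24 at β +
(11/(6π²))·log(3/2)), separations n = 2 ↦ 3: the ratio [3⁸·Cov_{24,β′}(3)]/[2⁸·Cov_{16,β}(2)] must
sit in a fixed [c/C, C/c] and drift
to 1 as β grows — it does in every published step-scaling study (LuscherWeiszWolff1991,
arXiv:1211.3247), which is why the crux is
believed. Desk falsifier of the ENGINE (not of the crux): run the dictionary on lattice YM₂ (exactly
solvable by characters; tree
ContinuumLimitsYM2*): Boué–Dupuis with the trivial drift must reproduce a-uniform two-sided bounds
on plaquette covariances and
Migdal's area law in finite volume; if the BD lower bound already fails there (degenerate coercivity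
along gauge orbits without K3),
the engine is dead before marginality. Cheapest test that the REPAIR is not cosmetic (done on paper
above, § WHY THIS LINE): compact
U(1) passes the typed item and fails C′.

NUMBERS. One-loop: b₀ = 11N/(48π²) for SU(N); in the tree's Wave-0 normalisation (weight e^(−β Σ_p
(N − Re tr U_p)), fundamental
SU(N)) β = 2/g₀², so β(a) = (11N/(12π²))·log(1/(aΛ_L)) + O(log log) — slope 11N/(12π²), NOT the
tree's `afCoefficient N = 11N/(48π²)`
whose docstring assumes β = 2N/g² (flag for the Literature maintainers; every statement here avoids
coefficients through the
existential a). Two-loop: b₁ = 34N²/(3(16π²)²). Tree level of the reference pair: ⟨F₀₁(0)F₀₁(n e₂)⟩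
= 1/(π²n⁴) per colour component,
so n⁸·Cov ≍ 2·dimG·g⁴(n a) > 0; lattice kernel band π²n⁴|K_{L,θ}(ne₂)| ∈ [0.6797, 1.8101] for L ≤
4096, all twists (j013308,
MaxwellKernelBand p94229); femto-box finite-size effects (torons, constant modes, images) are
O(g₀⁴L⁻⁸), relative size ≤ O(1) at
n ≤ L/8 (Luscher1983, CosteEtAl1985); SU(2) MC: β²C_⊥(1) L-independent within ±1% (j009165), ratio
tests saturate at 3.84–4.31
(j014620). SZZ: K_S = N/2 − 8N|β|(d−1) > 0 only for |β| < 1/(16(d−1)) — the strong-coupling end;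
nothing at weak coupling. Items now:
14 — 5 cruxes (16204, 16205, 16206, 16207 + shared 8896), 7 support (9363, 9365, 9366, 16110, 9367
superseded; 9364, 9368 closed),
1 informal support (9751), 1 assembly (closed).

DEFINITION REQUESTS. D1 `latticeLangevinDynamics` LANDED (p51009;
Literature/MathematicalPhysics/QuantumFieldTheory/
LatticeLangevinDynamics.lean: LinkSDE, IsSolution, markovTransition, IsFlatBrownian). D2
`boueDupuisValue` (topic
Literature/Probability): the BD variational value inf over progressively measurable drifts v of
E[F(W + ∫v) + ½∫|v|²] for bounded
measurable F of a finite-dimensional Brownian path on [0,T], with the representation theorem −log E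
e^(−F(W)) = value as a NAMED
FACT (BoueDupuis1998 Thm 3.1 p. 1647; BarashkovGubinelli2020 Thm 2) — OPEN (Mathlib lacks Wiener
measure: sizeable). D3 (optional,
rigid-sector pivot) `twistedWilsonMeasure`. Cite facts wanted: none beyond D2's representation
theorem.

Novelty: Searches (2026-08-15, opening seat): `lit search --source arxiv|zbmath "Barashkov Gubinelli"` /
`"Boué Dupuis"` (BG 2020/2021/2023,
Gubinelli–Meyer FBSDE arXiv:2401.13648, Barashkov–Gunaratnam arXiv:2506.21466, BBD Polchinski survey
doi:10.1214/24-ps27,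
Chandra–Ferdinand tensor fields, Budhiraja extensions arXiv:2403.01562 — all scalar/subcritical, no
gauge, no marginal model);
`"stochastic control variational lattice Yang-Mills"`, `"Boue-Dupuis formula lattice gauge theory"`,
`"stochastic quantization
lattice Yang-Mills uniform in lattice spacing"` (0 relevant). Searches (2026-08-16, this seat, index
up): `lit search --hybrid
"Boué-Dupuis variational formula gauge theory Yang-Mills lattice"` (10 book hits: Montvay–Münster,
Rivasseau 1991, Friz–König–…
2019, none on a variational construction of a gauge measure); `lit search --source arxiv
"variational approach Yang-Mills measure
Boué-Dupuis"` (0); `lit search --source arxiv --year-from 2018 "Barashkov Gubinelli variational"`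
(11: adds Deuschel–Thierbach
arXiv:2608.01860 Aviles–Giga Gibbs measure — still no gauge theory); `lit galaxy search
"Boué-Dupuis" --star all` (panama 0, pdf 10:
Serres overview, Eldan statement, dispersive Gibbs-measure papers, Osuka G-Brownian BD, Sundar–Tao —
no gauge theory);
`lit galaxy search "lattice Yang-Mills Langevin" --star all` (0); `lit search --source arxiv
"lattice gauge theories weak coupling
correlation decay"` (Adhikari–Cao arXiv:2202.10375: FINITE gauge groups at weak coupling decay ex  [refs: 10.1214/24-ps27, 10.1215/00127094-2020-0029, 10.1007/s00220-022-04609-1, 10.1007/bf02097397, 10.1007/bf01217741, 10.1016/0550-3213(91, 2401.13648, 2506.21466, 2403.01562, 2608.01860, 2202.10375, 2401.10507, 2311.18696, 1211.3247, 1803.01950, doi:10.1214/24-ps27, paper:arxiv-1805.10814, paper:arxiv-2204.12737, doi:10.1215/00127094-2020-0029, doi:10.1007/s00220-022-04609-1, doi:10.1007/bf02097397, d]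

Barriers (technique_class: stochastic-control-variational, langevin-rg): - technique_class: stochastic-control-variational, langevin-rg
- Literature.Barriers.QuantumFields.StochasticQuantisationCriticality: evaded by staying on the
lattice — the SDE is finite-dimensional and globally well-posed at every spacing (SZZ; tree
`latticeLangevinDynamics`), the continuum is approached through a-uniform BOUNDS along RG chains
(FemtoCurvatureTwoPointC), never through a d = 4 singular SPDE; criticality re-enters only as the
marginal coupling flow, met by exact one-loop drift + Σg⁴ < ∞ (MarginalFlowLemma, proved) — honest
form: it does not make d = 4 subcritical; the bet is borderline summability as in Gawędzki–Kupiainen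
/ BBS.
- Literature.Barriers.QuantumFields.UVStabilityNonUniqueness: the deliverables are two-sided bounds
plus SUBSEQUENTIAL limits (OSLegsAtWeakCouplingC uses the Y2 licence), uniqueness is never claimed;
unlike stability of effective densities, the BD value function is the generating functional of
observables, so bounds land on correlators directly — and C′ asks for exactly the missing piece
(observables, RG-consistent), not for stability again.
- Literature.Barriers.QuantumFields.ElitzurTheorem: respected — only gauge-invariant F (plaquette
fields, YMSpecies) are ever bounded; vertical (gauge-orbit) noise is free in the control problem
(card K3, horizontal controls).
- Literature.Barriers.QuantumFields.PerturbativeInvisibility: it does not evade it —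
LatticeGapInUVUnitsC (the gap e^(−1/(2b₀g²)) in units a) is IMPORTED from infrared routes

History (route lifecycle, newest last):
- 2026-08-15T14:16:50Z · rev 2: dropped Thesis — drop the optional target item Thesis (stmt-QuantumFields-9362): it is the bare conjunction of this route's five crux decls and was rendered before them (gate TO (planner-plancard-QuantumFields-YangMills-lang-fa4bd133-0)
- 2026-08-16T17:49:35Z · rev 10: restated Assembly (stmt-QuantumFields-9369 proved) — route-repair follow-up: re-point the optional Assembly item at OSLegsAtWeakCoupling. With the revised YangMills the old chain (… → OSLegsFromFemtoAndGap → GapTo (planner-rrepair-QuantumFields-LangevinControlU-591915b6-0)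
- 2026-08-16T18:14:00Z · rev 15: restated Assembly (stmt-QuantumFields-16166 proved) — promote-to-A step 3c (repair C′): re-point the optional Assembly item at the C chain — Assembly := FemtoCurvatureTwoPointC → FemtoCurvatureSkewnessC → LatticeGa (planner-promote-QuantumFields-LangevinControlU-abcda0b3-0)
- 2026-08-24T14:33:37Z · DORMANT — reconciler: no traction for 6.8 d (last activity item-evidence-added at 2026-08-17T18:03:45Z); parked, not closed — `ledger route dormant route-QuantumFields-La (operator:999:1228313)
- 2026-08-28T02:02:23Z · REACTIVATED — reconciler: reactivated — activity item-evidence-added at 2026-08-28T00:39:23Z after parking at 2026-08-24T14:33:37Z (operator:999:2318480)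
- 2026-09-02T19:38:46Z · DORMANT — reconciler: no traction for 5 d (last activity statement-checked at 2026-08-28T18:56:48Z); parked, not closed — `ledger route dormant route-QuantumFields-Langev (operator:999:2403567)

sub-problem: YangMills · status: dormant · opened planner-plancard-QuantumFields-YangMills-lang-fa4bd133-0 2026-08-15T13:56:25Z · rev 20 · ledger route-QuantumFields-LangevinControlUV
GENERATED by the gate from the ledger (D-0016/17). Provers cite these decls: `theorem foo : Summit.QuantumFields.YangMills.Theses.LangevinControlUV.<Decl> := …` in Summits/QuantumFields/YangMills/Theorems/<Name>.lean.
-/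

namespace Summit.QuantumFields.YangMills.Theses.LangevinControlUV

open scoped BigOperators Topology Manifold Classical MeasureTheory ProbabilityTheory Matrix InnerProductSpace ComplexConjugate ContinuousMap
open Filter Set Function TopologicalSpace MeasureTheory

attribute [summit_statement] _root_.YangMills

/-- item stmt-QuantumFields-16204 · crux · rank 2 · open · by planner
why it might fail: Needs a-UNIFORM two-sided control of a dim-8 composite along every RG chain n·a(β)=s with L=8n→∞: the BD engine's error Σ_j g_j⁴ ≍ g²(s) is the size of the signal's own running, and lattice artefacts at n≤3 and toron/zero-mode terms at n≍L/8 must stay inside ONE [c,C] for all β.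
sources: BarashkovGubinelli2020, BoueDupuis1998, ShenZhuZhu2022, Balaban1988Convergent, MagnenRivasseauSeneor1993, Luscher1983
[crux] (TIER-DECIDING crux, repair C′ = CONTINUOUS intrinsic units; supersedes
FemtoCurvatureTwoPoint stmt-QuantumFields-9363 as the hypothesis of `closes`; verbatim that body
with `Continuous a ∧` inserted) for every compact simple G and faithful unitary lattice
representation r there are a CONTINUOUS unit map a : ℝ → ℝ (a(β) > 0, a(β) → 0 at +∞), a shape Γ
with 0 < Γ ≤ 1 on (0, ℓ₀] and β₀, ℓ₀, c, C > 0 such that on every femto torus (L·a(β) ≤ ℓ₀, β ≥ β₀):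
(axis, two-sided) c·Γ(n·a(β)) ≤ n⁸·Cov(P_0^(01), P_(n e₂)^(01)) ≤ C·Γ(n·a(β)) for 1 ≤ n ≤ L/8, and
(all pairs, upper) |Cov(P_x^(ij), P_y^(i′j′))|·dist(x,y)⁸ ≤ C·Γ(dist(x,y)·a(β)) for x ≠ y. WHY THE
ONE TOKEN (kernel-checked, Cruxes/FemtoCurvatureTwoPoint/Disproof.lean § Repairs): as typed Γ
couples two data points ONLY at equal arguments n·a(β) = n′·a(β′) (`cross_comparable`); a generic
STEP unit map makes every level set a singleton, so the typed item ⟸ fixed-torus β⁻² semiclassics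
(`encoding`, line generic-step-gamma-encoding; U(1) passes, non-abelian-ness not load-bearing: no UV
content). Under `Continuous a` every pair n < n′ is coupled at all large β to a later β′ with
n′·a(β′) = n·a(β) (`exists_later_level`, `rg_chain_of_c -/
@[route_item "route-QuantumFields-LangevinControlUV"]
def FemtoCurvatureTwoPointC : Prop :=
  open Literature.MathematicalPhysics.QuantumFieldTheory in ∀ (G : Type) [Group G] [TopologicalSpace G] [IsTopologicalGroup G] [CompactSpace G], IsCompactSimpleLieGroup G → letI : MeasurableSpace G := borel G; haveI : BorelSpace G := ⟨rfl⟩; ∀ (r : LatticeRep G), ∃ (a : ℝ → ℝ), Continuous a ∧ ∃ (Γ : ℝ → ℝ) (β₀ ℓ₀ c C : ℝ), 0 < ℓ₀ ∧ 0 < c ∧ (∀ β, 0 < a β) ∧ Filter.Tendsto a Filter.atTop (nhds 0) ∧ (∀ s : ℝ, 0 < s → s ≤ ℓ₀ → 0 < Γ s ∧ Γ s ≤ 1) ∧ ∀ (L : ℕ) [NeZero L] (β : ℝ), β₀ ≤ β → (L : ℝ) * a β ≤ ℓ₀ → let P : (Fin 4 → ZMod L) → Fin 4 → Fin 4 → GaugeConfig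 4 L G → ℝ := fun x i j U => (r.N : ℝ) - (r.ρ (plaquetteHolonomy U x i j)).trace.re; let E : (GaugeConfig 4 L G → ℝ) → ℝ := fun F => wilsonExpectation (d := 4) (L := L) r.ρ β F; let cov : (GaugeConfig 4 L G → ℝ) → (GaugeConfig 4 L G → ℝ) → ℝ := fun F F' => E (fun U => F U * F' U) - E F * E F'; let dist : (Fin 4 → ZMod L) → (Fin 4 → ZMod L) → ℝ := fun x y => Real.sqrt (∑ k : Fin 4, (((x k - y k).valMinAbs : ℤ) : ℝ) ^ 2); (∀ n : ℕ, 1 ≤ n → 8 * n ≤ L → c * Γ ((n : ℝ) * a β) ≤ (n : ℝ) ^ 8 * cov (P 0 0 1) (P (Pi.single (2 : Fin 4) ((n : ℕ) : ZMod L)) 0 1) ∧ (n : ℝ) ^ 8 * cov (P 0 0 1) (P (Pi.single (2 : Fin 4) ((n : ℕ) : ZMod L)) 0 1) ≤ C * Γ ((n : ℝ) * a β)) ∧ (∀ (x y : Fin 4 → ZMod L) (i j i' j' : Fin 4), x ≠ y → i ≠ j → i' ≠ j' → |cov (P x i j) (P y i' j')| * dist x y ^ 8 ≤ C * Γ (dist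 x y * a β))

/-- item stmt-QuantumFields-16205 · crux · rank 4 · open · by planner
why it might fail: A LOWER bound on an odd cumulant needs sign control uniformly along RG chains: the one-loop remainder and toron/constant-mode terms (O(g⁶L⁻¹²) at n≍L/8) must not cancel the positive tree triangle; for r⊗r∋r̄ (SU(3) fundamental) the strong-coupling sign is −, so ℓ₁ must sit below the flip scale.
sources: LuscherWeisz2011, CosteEtAl1985, Luscher1983, BarashkovGubinelli2020, MagnenRivasseauSeneor1993
[crux] (lattice-side `IsNonGaussian` witness IN THE ENGINE'S OWN CONTINUOUS UNITS — repair R1∘C′ of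
FemtoCurvatureSkewness stmt-QuantumFields-9365) for every compact simple G and faithful unitary r:
IF some continuous unit map carries the femto two-point package (= FemtoCurvatureTwoPointC at (G,
r)), THEN some continuous unit map a carries the package AND the skewness witness — Γ₃ > 0 on (0,
ℓ₁], β₁, ℓ₁, c₃ > 0 with n¹²·|κ₃(P_0^(01), P_(n e₂)^(01), P_(n e₃)^(01))| ≥ c₃·Γ₃(n·a(β)) for 1 ≤ n
≤ L/8 on every femto torus L·a(β) ≤ ℓ₁, β ≥ β₁ (tree level: the triangle contraction
8·dimG·Π⟨F₀₁F₀₁⟩ > 0 at order g⁶, all three free propagators positive at mutually perpendicular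
displacements — LANDED PerpPropagatorPos p90356, PermanentalRigidity p88811). ∃-BUNDLED ON PURPOSE
(Cruxes/FemtoCurvatureSkewness/Memo-forall-a-exposure.md §3/§6 R1;
Negative-PackagePinsScale-lead.md): the typed ∀a shell demanded κ₃ ≠ 0 along parasitic unit maps,
i.e. GLOBAL non-vanishing at confinement-scale triangles (open infrared sign question;
`FemtoCurvatureSkewness_false_of_UniformZeros`, `packagePinsScale_iff_package_unsatisfiable`
p94300), while `closes` only needs the witness at ONE package map, which this it -/
@[route_item "route-QuantumFields-LangevinControlUV"]
def FemtoCurvatureSkewnessC : Prop :=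
  open Literature.MathematicalPhysics.QuantumFieldTheory in ∀ (G : Type) [Group G] [TopologicalSpace G] [IsTopologicalGroup G] [CompactSpace G], IsCompactSimpleLieGroup G → letI : MeasurableSpace G := borel G; haveI : BorelSpace G := ⟨rfl⟩; ∀ (r : LatticeRep G), (∃ (a : ℝ → ℝ), Continuous a ∧ (∃ (Γ : ℝ → ℝ) (β₀ ℓ₀ c C : ℝ), 0 < ℓ₀ ∧ 0 < c ∧ (∀ β, 0 < a β) ∧ Filter.Tendsto a Filter.atTop (nhds 0) ∧ (∀ s : ℝ, 0 < s → s ≤ ℓ₀ → 0 < Γ s ∧ Γ s ≤ 1) ∧ ∀ (L : ℕ) [NeZero L] (β : ℝ), β₀ ≤ β → (L : ℝ) * a β ≤ ℓ₀ → let P : (Fin 4 → ZMod L) → Fin 4 → Fin 4 → GaugeConfig 4 L G → ℝ := fun x i j U => (r.N : ℝ) - (r.ρ (plaquetteHolonomy U x i j)).trace.re; let E : (GaugeConfig 4 L G → ℝ) → ℝ := fun F => wilsonExpectation (d := 4) (L := L) r.ρ β F; let cov : (GaugeConfig 4 L G → ℝ) → (GaugeConfig 4 L G → ℝ) → ℝ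 := fun F F' => E (fun U => F U * F' U) - E F * E F'; let dist : (Fin 4 → ZMod L) → (Fin 4 → ZMod L) → ℝ := fun x y => Real.sqrt (∑ k : Fin 4, (((x k - y k).valMinAbs : ℤ) : ℝ) ^ 2); (∀ n : ℕ, 1 ≤ n → 8 * n ≤ L → c * Γ ((n : ℝ) * a β) ≤ (n : ℝ) ^ 8 * cov (P 0 0 1) (P (Pi.single (2 : Fin 4) ((n : ℕ) : ZMod L)) 0 1) ∧ (n : ℝ) ^ 8 * cov (P 0 0 1) (P (Pi.single (2 : Fin 4) ((n : ℕ) : ZMod L)) 0 1) ≤ C * Γ ((n : ℝ) * a β)) ∧ (∀ (x y : Fin 4 → ZMod L) (i j i' j' : Fin 4), x ≠ y → i ≠ j → i' ≠ j' → |cov (P x i j) (P y i' j')| * dist x y ^ 8 ≤ C * Γ (dist x y * a β)))) → ∃ (a : ℝ → ℝ), Continuous a ∧ (∃ (Γ : ℝ → ℝ) (β₀ ℓ₀ c C : ℝ), 0 < ℓ₀ ∧ 0 < c ∧ (∀ β, 0 < a β) ∧ Filter.Tendsto a Filter.atTop (nhds 0) ∧ (∀ s : ℝ, 0 < s → s ≤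 ℓ₀ → 0 < Γ s ∧ Γ s ≤ 1) ∧ ∀ (L : ℕ) [NeZero L] (β : ℝ), β₀ ≤ β → (L : ℝ) * a β ≤ ℓ₀ → let P : (Fin 4 → ZMod L) → Fin 4 → Fin 4 → GaugeConfig 4 L G → ℝ := fun x i j U => (r.N : ℝ) - (r.ρ (plaquetteHolonomy U x i j)).trace.re; let E : (GaugeConfig 4 L G → ℝ) → ℝ := fun F => wilsonExpectation (d := 4) (L := L) r.ρ β F; let cov : (GaugeConfig 4 L G → ℝ) → (GaugeConfig 4 L G → ℝ) → ℝ := fun F F' => E (fun U => F U * F' U) - E F * E F'; let dist : (Fin 4 → ZMod L) → (Fin 4 → ZMod L) → ℝ := fun x y => Real.sqrt (∑ k : Fin 4, (((x k - y k).valMinAbs : ℤ) : ℝ) ^ 2); (∀ n : ℕ, 1 ≤ n → 8 * n ≤ L → c * Γ ((n : ℝ) * a β) ≤ (n : ℝ) ^ 8 * cov (P 0 0 1) (P (Pi.single (2 : Fin 4) ((n : ℕ) : ZMod L)) 0 1) ∧ (n : ℝ) ^ 8 * cov (P 0 0 1) (P (Pi.single (2 : Fin 4) ((n : ℕ) : ZMod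 L)) 0 1) ≤ C * Γ ((n : ℝ) * a β)) ∧ (∀ (x y : Fin 4 → ZMod L) (i j i' j' : Fin 4), x ≠ y → i ≠ j → i' ≠ j' → |cov (P x i j) (P y i' j')| * dist x y ^ 8 ≤ C * Γ (dist x y * a β))) ∧ (∃ (Γ₃ : ℝ → ℝ) (β₁ ℓ₁ c₃ : ℝ), 0 < ℓ₁ ∧ 0 < c₃ ∧ (∀ s : ℝ, 0 < s → s ≤ ℓ₁ → 0 < Γ₃ s) ∧ ∀ (L : ℕ) [NeZero L] (β : ℝ), β₁ ≤ β → (L : ℝ) * a β ≤ ℓ₁ → let P : (Fin 4 → ZMod L) → Fin 4 → Fin 4 → GaugeConfig 4 L G → ℝ := fun x i j U => (r.N : ℝ) - (r.ρ (plaquetteHolonomy U x i j)).trace.re; let E : (GaugeConfig 4 L G → ℝ) → ℝ := fun F => wilsonExpectation (d := 4) (L := L) r.ρ β F; let cov : (GaugeConfig 4 L G → ℝ) → (GaugeConfig 4 L G → ℝ) → ℝ := fun F F' => E (fun U => F U * F' U) - E F * E F'; ∀ n : ℕ, 1 ≤ n → 8 * n ≤ L → c₃ * Γ₃ ((n : ℝ)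 * a β) ≤ (n : ℝ) ^ 12 * |E (fun U => P 0 0 1 U * P (Pi.single (2 : Fin 4) ((n : ℕ) : ZMod L)) 0 1 U * P (Pi.single (3 : Fin 4) ((n : ℕ) : ZMod L)) 0 1 U) - E (P 0 0 1) * cov (P (Pi.single (2 : Fin 4) ((n : ℕ) : ZMod L)) 0 1) (P (Pi.single (3 : Fin 4) ((n : ℕ) : ZMod L)) 0 1) - E (P (Pi.single (2 : Fin 4) ((n : ℕ) : ZMod L)) 0 1) * cov (P 0 0 1) (P (Pi.single (3 : Fin 4) ((n : ℕ) : ZMod L)) 0 1) - E (P (Pi.single (3 : Fin 4) ((n : ℕ) : ZMod L)) 0 1) * cov (P 0 0 1) (P (Pi.single (2 : Fin 4) ((n : ℕ) : ZMod L)) 0 1) - E (P 0 0 1) * E (P (Pi.single (2 : Fin 4) ((n : ℕ) : ZMod L)) 0 1) * E (P (Pi.single (3 : Fin 4) ((n : ℕ) : ZMod L)) 0 1)|)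

/-- item stmt-QuantumFields-16206 · crux · rank 5 · open · by planner
why it might fail: It IS the Millennium gap in UV units (barrier PerturbativeInvisibility: no expansion in g sees e^(−1/(2b₀g²))): needs one β-uniform non-perturbative mixing certificate at cell ⌈K/a(β)⌉ through intermediate volumes with light torelons; this route imports it and claims no mechanism for it.
sources: JaffeWitten2000, arXiv180301950, Literature.MathematicalPhysics.QuantumFieldTheory.LatticeMassGapAllCouplings, Literature.Barriers.QuantumFields.PerturbativeInvisibility, OsterwalderSeiler1978, LuscherWeiszWolff1991
[crux] (IMPORTED infrared leg in the engine's CONTINUOUS units — repair C′ of LatticeGapInUVUnits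
stmt-QuantumFields-9366; VERBATIM the standing disprover's `CruxRepaired` and the conclusion of the
LANDED line reductions `cruxRepaired_of_blockSamplerCertificate` (knabe-block-sampler,
…LatticeGapInUVUnitsReduction p92432) and `cruxRepaired_of_femtoSlab` (femto-slab-nondegeneracy,
…SlabReduction p99152) — both kernel-checked against this exact body by type ascription, folder
Check2.lean rc 0) for every G, r and every CONTINUOUS unit map a carrying the femto two-point
package there are c₁ > 0, β₂ and S₁ : ℝ → ℕ such that for all gauge-invariant local lattice
observables A, B there is C with |⟨A·τ_n B⟩ − ⟨A⟩⟨B⟩| ≤ C·exp(−c₁·a(β)·n) on every torus of side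
2S+1 ≥ 2S₁(β)+1, β ≥ β₂, n ≤ S (`latticeConnectedCorr`): the lattice mass gap is ≥ c₁ in the units
of the UV engine, uniformly in the volume (ξ(β)·a(β) bounded — dimensional transmutation made
explicit). WHY CONTINUITY: as typed (∀ a) the item served slowly-decaying generic step maps and then
demanded ξ(β) = O(1/a(β)) ≪ asymptotic scaling — refuted MODULO StandardScalingSU
(Cruxes/LatticeGapInUVUnits/TypedDefect9366.md; Disproof p80025 -/
@[route_item "route-QuantumFields-LangevinControlUV"]
def LatticeGapInUVUnitsC : Prop :=
  open Literature.MathematicalPhysics.QuantumFieldTheory in ∀ (G : Type) [Group G] [TopologicalSpace G] [IsTopologicalGroup G] [CompactSpace G], IsCompactSimpleLieGroup G → letI : MeasurableSpace G := borel G; haveI : BorelSpace G := ⟨rfl⟩; ∀ (r : LatticeRep G) (a : ℝ → ℝ), Continuous a → (∃ (Γ : ℝ → ℝ) (β₀ ℓ₀ c C : ℝ), 0 < ℓ₀ ∧ 0 < c ∧ (∀ β, 0 < a β) ∧ Filter.Tendsto a Filter.atTop (nhds 0) ∧ (∀ s : ℝ, 0 < s → s ≤ ℓ₀ → 0 < Γ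 s ∧ Γ s ≤ 1) ∧ ∀ (L : ℕ) [NeZero L] (β : ℝ), β₀ ≤ β → (L : ℝ) * a β ≤ ℓ₀ → let P : (Fin 4 → ZMod L) → Fin 4 → Fin 4 → GaugeConfig 4 L G → ℝ := fun x i j U => (r.N : ℝ) - (r.ρ (plaquetteHolonomy U x i j)).trace.re; let E : (GaugeConfig 4 L G → ℝ) → ℝ := fun F => wilsonExpectation (d := 4) (L := L) r.ρ β F; let cov : (GaugeConfig 4 L G → ℝ) → (GaugeConfig 4 L G → ℝ) → ℝ := fun F F' => E (fun U => F U * F' U) - E F * E F'; let dist : (Fin 4 → ZMod L) → (Fin 4 → ZMod L) → ℝ := fun x y => Real.sqrt (∑ k : Fin 4, (((x k - y k).valMinAbs : ℤ) : ℝ) ^ 2); (∀ n : ℕ, 1 ≤ n → 8 * n ≤ L → c * Γ ((n : ℝ) * a β) ≤ (n : ℝ) ^ 8 * cov (P 0 0 1) (P (Pi.single (2 : Fin 4) ((n : ℕ) : ZMod L)) 0 1) ∧ (n : ℝ) ^ 8 * cov (P 0 0 1) (P (Pi.single (2 : Fin 4) ((n : ℕ) : ZMod L)) 0 1) ≤ C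 * Γ ((n : ℝ) * a β)) ∧ (∀ (x y : Fin 4 → ZMod L) (i j i' j' : Fin 4), x ≠ y → i ≠ j → i' ≠ j' → |cov (P x i j) (P y i' j')| * dist x y ^ 8 ≤ C * Γ (dist x y * a β))) → ∃ (c₁ β₂ : ℝ) (S₁ : ℝ → ℕ), 0 < c₁ ∧ ∀ A B : YMSpecies G, ∃ C : ℝ, ∀ β : ℝ, β₂ ≤ β → ∀ S n : ℕ, S₁ β ≤ S → n ≤ S → |latticeConnectedCorr r.ρ β (2 * S + 1) A.F B.F n| ≤ C * Real.exp (-(c₁ * a β * n))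

/-- item stmt-QuantumFields-16207 · crux · rank 6 · open · by planner
why it might fail: Hides E1 (rotation invariance of subsequential hypercubic limits; barrier RegularisationDichotomy), E0′ for ALL species at the confinement scale, and the femto→large-torus decoupling (H1/H2 are eventually vacuous on the scheme's own tori); compactness gives none of them.
sources: OsterwalderSchrader1975, OsterwalderSeiler1978, Seiler1982, GlimmJaffe1987, JaffeWitten2000, DavoudiSavage2012
[crux] (the OS legs AT WEAK COUPLING in CONTINUOUS units — repair C′ of OSLegsAtWeakCoupling
stmt-QuantumFields-16110 (itself stmt-9367 + `sch.HasWeakCouplingLimit`), verbatim with `Continuous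
a →` inserted; both older items imply it) for every G, r and CONTINUOUS unit map a: the femto
two-point package ∧ the skewness witness ∧ the clustering in units a imply ∃ sequential scheme sch
in units a (sch.a k = a(sch.β k)) with sch.HasWeakCouplingLimit and OS data T (E0, E0′, E1–E4) with
`IsYangMillsFor r sch T`, `T.IsNontrivial r.curvature`, `T.IsNonGaussian r.curvature` and
`HasLatticeMassGap r sch Δ` for some Δ > 0 (c_curv(k) := a_k⁻⁴, diagonal subsequences over species ×
test functions, species off a countable family zeroed; compactness licensed by ruling Y2;
`HasLatticeMassGap` is the infrared hypothesis re-indexed with L_k ≥ S₁(β_k),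
`hasLatticeMassGap_of_gapInUnits` p72925). WHY CONTINUITY: the registered stub `stub_pin` of line
dlr-collar-transfer (TwoPoint ∧ GapInUnits ⇒ TwoPointPinned for ARBITRARY a) was this crux's typing
residue X1 (Cruxes/OSLegsFromFemtoAndGap/Disproof.lean §6/§8: fast step maps with pairwise
incommensurable plateaux smear the curvature over ≫ ξ lattice unit -/
@[route_item "route-QuantumFields-LangevinControlUV"]
def OSLegsAtWeakCouplingC : Prop :=
  open Literature.MathematicalPhysics.QuantumFieldTheory in ∀ (G : Type) [Group G] [TopologicalSpace G] [IsTopologicalGroup G] [CompactSpace G], IsCompactSimpleLieGroup G → letI : MeasurableSpace G := borel G; haveI : BorelSpace G := ⟨rfl⟩; ∀ (r : LatticeRep G), ∀ (a : ℝ → ℝ), Continuous a → (∃ (Γ : ℝ → ℝ) (β₀ ℓ₀ c C : ℝ), 0 < ℓ₀ ∧ 0 < c ∧ (∀ β, 0 < a β) ∧ Filter.Tendsto a Filter.atTop (nhds 0) ∧ (∀ s : ℝ, 0 < s → s ≤ ℓ₀ → 0 < Γ s ∧ Γ s ≤ 1) ∧ ∀ (L : ℕ) [NeZero L] (β : ℝ),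 β₀ ≤ β → (L : ℝ) * a β ≤ ℓ₀ → let P : (Fin 4 → ZMod L) → Fin 4 → Fin 4 → GaugeConfig 4 L G → ℝ := fun x i j U => (r.N : ℝ) - (r.ρ (plaquetteHolonomy U x i j)).trace.re; let E : (GaugeConfig 4 L G → ℝ) → ℝ := fun F => wilsonExpectation (d := 4) (L := L) r.ρ β F; let cov : (GaugeConfig 4 L G → ℝ) → (GaugeConfig 4 L G → ℝ) → ℝ := fun F F' => E (fun U => F U * F' U) - E F * E F'; let dist : (Fin 4 → ZMod L) → (Fin 4 → ZMod L) → ℝ := fun x y => Real.sqrt (∑ k : Fin 4, (((x k - y k).valMinAbs : ℤ) : ℝ) ^ 2); (∀ n : ℕ, 1 ≤ n → 8 * n ≤ L → c * Γ ((n : ℝ) * a β) ≤ (n : ℝ) ^ 8 * cov (P 0 0 1) (P (Pi.single (2 : Fin 4) ((n : ℕ) : ZMod L)) 0 1) ∧ (n : ℝ) ^ 8 * cov (P 0 0 1) (P (Pi.single (2 : Fin 4) ((n : ℕ) : ZMod L)) 0 1) ≤ C * Γ ((n : ℝ) * a β)) ∧ (∀ (x y : Fin 4 → ZMod L) (i j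 i' j' : Fin 4), x ≠ y → i ≠ j → i' ≠ j' → |cov (P x i j) (P y i' j')| * dist x y ^ 8 ≤ C * Γ (dist x y * a β))) → (∃ (Γ₃ : ℝ → ℝ) (β₁ ℓ₁ c₃ : ℝ), 0 < ℓ₁ ∧ 0 < c₃ ∧ (∀ s : ℝ, 0 < s → s ≤ ℓ₁ → 0 < Γ₃ s) ∧ ∀ (L : ℕ) [NeZero L] (β : ℝ), β₁ ≤ β → (L : ℝ) * a β ≤ ℓ₁ → let P : (Fin 4 → ZMod L) → Fin 4 → Fin 4 → GaugeConfig 4 L G → ℝ := fun x i j U => (r.N : ℝ) - (r.ρ (plaquetteHolonomy U x i j)).trace.re; let E : (GaugeConfig 4 L G → ℝ) → ℝ := fun F => wilsonExpectation (d := 4) (L := L) r.ρ β F; let cov : (GaugeConfig 4 L G → ℝ) → (GaugeConfig 4 L G → ℝ) → ℝ := fun F F' => E (fun U => F U * F' U) - E F * E F'; ∀ n : ℕ, 1 ≤ n → 8 * n ≤ L → c₃ * Γ₃ ((n : ℝ) * a β) ≤ (n : ℝ) ^ 12 * |E (fun U => P 0 0 1 U * P (Pi.single (2 : Fin 4) ((n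 : ℕ) : ZMod L)) 0 1 U * P (Pi.single (3 : Fin 4) ((n : ℕ) : ZMod L)) 0 1 U) - E (P 0 0 1) * cov (P (Pi.single (2 : Fin 4) ((n : ℕ) : ZMod L)) 0 1) (P (Pi.single (3 : Fin 4) ((n : ℕ) : ZMod L)) 0 1) - E (P (Pi.single (2 : Fin 4) ((n : ℕ) : ZMod L)) 0 1) * cov (P 0 0 1) (P (Pi.single (3 : Fin 4) ((n : ℕ) : ZMod L)) 0 1) - E (P (Pi.single (3 : Fin 4) ((n : ℕ) : ZMod L)) 0 1) * cov (P 0 0 1) (P (Pi.single (2 : Fin 4) ((n : ℕ) : ZMod L)) 0 1) - E (P 0 0 1) * E (P (Pi.single (2 : Fin 4) ((n : ℕ) : ZMod L)) 0 1) * E (P (Pi.single (3 : Fin 4) ((n : ℕ) : ZMod L)) 0 1)|) → (∃ (c₁ β₂ : ℝ) (S₁ : ℝ → ℕ), 0 < c₁ ∧ ∀ A B : YMSpecies G, ∃ C : ℝ, ∀ β : ℝ, β₂ ≤ β → ∀ S n : ℕ, S₁ β ≤ S → n ≤ S → |latticeConnectedCorr r.ρ β (2 * S + 1) A.F B.F n|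 ≤ C * Real.exp (-(c₁ * a β * n))) → ∃ (sch : SpeciesScheme (YMSpecies G)) (T : OSData (YMSpecies G) 4), (∀ k, sch.a k = a (sch.β k)) ∧ sch.HasWeakCouplingLimit ∧ IsYangMillsFor r sch T ∧ T.IsNontrivial r.curvature ∧ T.IsNonGaussian r.curvature ∧ ∃ Δ > 0, HasLatticeMassGap r sch Δ

/-- item stmt-QuantumFields-8896 · crux · rank 9 · open · by planner
why it might fail: HasLatticeMassGap is ∃C ∀ᶠk per FIXED pair of lattice-local observables (pair-dependent threshold, no uniformity over translates); smeared fields are k-dependent sums of O(a_k⁻⁴ⁿ) such terms — constants do not sum, no fixed-k lattice spectral gap is forced: needs RP + OS reconstruction + uniformity.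
sources: OsterwalderSeiler1978, Seiler1982, GlimmJaffe1987, OsterwalderSchrader1975, JaffeWitten2000
[crux] (card assembly step "clustering passes to the limit") for every compact G, r, sch, T and Δ >
0: `IsYangMillsFor r sch T` and `HasLatticeMassGap r sch Δ` imply `T.HasMassGap Δ` — the
volume-uniform lattice clustering of ALL pairs of gauge-invariant observables at physical rate Δ
becomes, via the reflection-positive transfer matrix at each k (spectrum of e^{−a_kH} in {1} ∪ [0,
e^{−a_kΔ}] on the full lattice Hilbert space) and the convergence on ⁰𝒮, exponential clustering of
every truncated Schwinger function of T. [difficulty: M] -/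
@[route_item "route-QuantumFields-LangevinControlUV"]
def GapToContinuum : Prop :=
  ∀ (G : Type) [Group G] [TopologicalSpace G] [IsTopologicalGroup G] [CompactSpace G] [MeasurableSpace G] [BorelSpace G] (r : Literature.MathematicalPhysics.QuantumFieldTheory.LatticeRep G) (sch : Literature.MathematicalPhysics.QuantumFieldTheory.SpeciesScheme (Literature.MathematicalPhysics.QuantumFieldTheory.YMSpecies G)) (T : Literature.MathematicalPhysics.QuantumFieldTheory.OSData (Literature.MathematicalPhysics.QuantumFieldTheory.YMSpecies G) 4) (Δ : ℝ), 0 < Δ → Literature.MathematicalPhysics.QuantumFieldTheory.IsYangMillsFor r sch T → Literature.MathematicalPhysics.QuantumFieldTheory.HasLatticeMassGap r sch Δ → T.HasMassGap Δ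

/-- item stmt-QuantumFields-9363 · support · rank 2 · open · by planner
why it might fail: As typed ∃a is under-pinned: Γ is arbitrary and level sets n·a(β)=s of a generic STEP unit map never meet across β, so a slowly-decaying step a passes on fixed-L β→∞ (toron-sector) asymptotics alone — no UV engine, a≉a_AF. Honest continuous a: the open femto continuum limit with observables.
sources: BarashkovGubinelli2020, Balaban1989LargeFieldII, MagnenRivasseauSeneor1993, Luscher1983, CosteEtAl1985, Vanbaal2001
[crux] (card K1, as its observable output) for every compact simple G and faithful unitary lattice
representation r there are a unit map a : ℝ → ℝ (a(β) > 0, a(β) → 0), a shape function Γ with 0 < Γ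
≤ 1 on (0, ℓ₀], and constants β₀, ℓ₀, c, C > 0 such that on every periodic torus (ℤ/L)⁴ at coupling
β ≥ β₀ with physical size L·a(β) ≤ ℓ₀ (femto-universe), writing P_x^(ij) = N − Re tr r(U_p) for the
plaquette at x in the (i,j) plane and Cov for the covariance under `wilsonMeasure r.ρ β`:
(two-sided, axis) c·Γ(n·a(β)) ≤ n⁸·Cov(P_0^(01), P_(n e₂)^(01)) ≤ C·Γ(n·a(β)) for 1 ≤ n ≤ L/8;
(upper, all pairs) |Cov(P_x^(ij), P_y^(i′j′))|·dist(x,y)⁸ ≤ C·Γ(dist(x,y)·a(β)) for x ≠ y (torus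
Euclidean distance). The SAME Γ in both clauses pins a(β) to the physical (two-loop) scale and makes
c(k) := a_k⁻⁴ a legitimate curvature renormalisation downstream (non-zero, tempered two-point
function). [difficulty: open-problem] -/
@[route_item "route-QuantumFields-LangevinControlUV"]
def FemtoCurvatureTwoPoint : Prop :=
  open Literature.MathematicalPhysics.QuantumFieldTheory in ∀ (G : Type) [Group G] [TopologicalSpace G] [IsTopologicalGroup G] [CompactSpace G], IsCompactSimpleLieGroup G → letI : MeasurableSpace G := borel G; haveI : BorelSpace G := ⟨rfl⟩; ∀ (r : LatticeRep G), ∃ (a : ℝ → ℝ), ∃ (Γ : ℝ → ℝ) (β₀ ℓ₀ c C : ℝ), 0 < ℓ₀ ∧ 0 < c ∧ (∀ β, 0 < a β) ∧ Filter.Tendsto a Filter.atTop (nhds 0) ∧ (∀ s : ℝ, 0 < s → s ≤ ℓ₀ → 0 < Γ s ∧ Γ s ≤ 1) ∧ ∀ (L : ℕ) [NeZero L] (β : ℝ), β₀ ≤ β → (L : ℝ) * a β ≤ ℓ₀ → let P : (Fin 4 → ZMod L) → Fin 4 → Fin 4 → GaugeConfig 4 L G → ℝ := fun x i j U => (r.N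 : ℝ) - (r.ρ (plaquetteHolonomy U x i j)).trace.re; let E : (GaugeConfig 4 L G → ℝ) → ℝ := fun F => wilsonExpectation (d := 4) (L := L) r.ρ β F; let cov : (GaugeConfig 4 L G → ℝ) → (GaugeConfig 4 L G → ℝ) → ℝ := fun F F' => E (fun U => F U * F' U) - E F * E F'; let dist : (Fin 4 → ZMod L) → (Fin 4 → ZMod L) → ℝ := fun x y => Real.sqrt (∑ k : Fin 4, (((x k - y k).valMinAbs : ℤ) : ℝ) ^ 2); (∀ n : ℕ, 1 ≤ n → 8 * n ≤ L → c * Γ ((n : ℝ) * a β) ≤ (n : ℝ) ^ 8 * cov (P 0 0 1) (P (Pi.single (2 : Fin 4) ((n : ℕ) : ZMod L)) 0 1) ∧ (n : ℝ) ^ 8 * cov (P 0 0 1) (P (Pi.single (2 : Fin 4) ((n : ℕ) : ZMod L)) 0 1) ≤ C * Γ ((n : ℝ) * a β)) ∧ (∀ (x y : Fin 4 → ZMod L) (i j i' j' : Fin 4), x ≠ y → i ≠ j → i' ≠ j' → |cov (P x i j) (P y i' j')| * dist x y ^ 8 ≤ C * Γ (dist x y * a β))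

/-- item stmt-QuantumFields-9364 · support · rank 3 · closed · proved by Summit.QuantumFields.YangMills.Theorems.LangevinControlUVFemtoPoincare.FemtoPoincare_proof (prover) · by planner
why it might fail: Extended metastable structures (vortex sheets, Dirac-type artefacts) with barriers growing like L, or an entropic bottleneck between toron regions of the flat-connection variety, would force super-polynomial relaxation; SZZ's Bakry–Émery route stops at strong coupling ('t Hooft |β| < 1/(16(d−1))).
sources: Mathlib:ProbabilityTheory.variance_le_sq_of_bounded, Literature.MathematicalPhysics.QuantumFieldTheory.isProbabilityMeasure_wilsonMeasure, arXiv:hep-lat/0211004, ShenZhuZhu2022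
[crux] (card K2: finite fictitious time reaches μ_β; no e^(cβ) metastability) for every compact
simple G and faithful unitary r there is κ > 0 such that for every κ′ ≥ κ there are p, C with: for
every torus (ℤ/L)⁴ and every β in the deep-femto band κ(1+log L) ≤ β ≤ κ′(1+log L), Wilson's measure
satisfies Var(F) ≤ C·L^p·Σ_e lip_e(F)² for every bounded measurable F that is lip_e-Lipschitz in
each link w.r.t. the Frobenius metric pulled back by r.ρ — i.e. the spectral gap of the SZZ Langevin
generator (Dirichlet form Σ_e ∫|∇_e F|²) is at least (C L^p)⁻¹: relaxation in Langevin time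
polynomial in ℓ/a. A band, not β → ∞ at fixed L: lattice-artefact local minima (which exist for some
(G,r), e.g. r ∋ adjoint where U_p = −1 is a local max of Re tr r) have Arrhenius times e^(βΔS) =
L^(O(κ′)) inside the band. [difficulty: XL] -/
@[route_item "route-QuantumFields-LangevinControlUV"]
def FemtoPoincare : Prop :=
  open Literature.MathematicalPhysics.QuantumFieldTheory in ∀ (G : Type) [Group G] [TopologicalSpace G] [IsTopologicalGroup G] [CompactSpace G], IsCompactSimpleLieGroup G → letI : MeasurableSpace G := borel G; haveI : BorelSpace G := ⟨rfl⟩; ∀ (r : LatticeRep G), ∃ κ : ℝ, 0 < κ ∧ ∀ κ' : ℝ, κ ≤ κ' → ∃ (p : ℕ) (C : ℝ), ∀ (L : ℕ) [NeZero L] (β : ℝ), κ * (1 + Real.log L) ≤ β → β ≤ κ' * (1 + Real.log L) → ∀ (F : GaugeConfig 4 L G → ℝ) (lip : Edge 4 L → ℝ), Measurable F → (∃ M : ℝ, ∀ U, |F U| ≤ M) → (∀ e, 0 ≤ lip e) → (∀ (U : GaugeConfig 4 L G) (e : Edge 4 L) (g : G), |F (Function.update U e g) - F U| ≤ lip e *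 Real.sqrt (∑ i, ∑ j, ‖(r.ρ g - r.ρ (U e)) i j‖ ^ 2)) → wilsonExpectation (d := 4) (L := L) r.ρ β (fun U => F U ^ 2) - (wilsonExpectation (d := 4) (L := L) r.ρ β F) ^ 2 ≤ C * (L : ℝ) ^ p * ∑ e : Edge 4 L, lip e ^ 2

-- `FemtoPoincare` holds: proved by `Summit.QuantumFields.YangMills.Theorems.LangevinControlUVFemtoPoincare.FemtoPoincare_proof` (its module imports this route file, so no `_holds` link can be stated here).

/-- item stmt-QuantumFields-9365 · support · rank 4 · open · by planner
why it might fail: ∀a covers every unit map passing the unpinned 2-pt package, incl. fast-decaying step maps whose boxes L·a≤ℓ₁ reach confinement-scale separations where the odd cumulant κ₃ can cross zero; |κ₃|≥c₃Γ₃>0 needs EXACT non-vanishing at every β of a band. Honest a: cutoff-uniform lower bound, dim-12 3-pt fn.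
sources: LuscherWeisz2011, CosteEtAl1985, Luscher1983, MagnenRivasseauSeneor1993, BarashkovGubinelli2020
[crux] (lattice-side `IsNonGaussian` witness from the same engine) for every G, r and every unit map
a for which the FemtoCurvatureTwoPoint bounds hold, there are Γ₃ > 0 on (0, ℓ₁], β₁, ℓ₁, c₃ > 0 such
that on every femto torus (L·a(β) ≤ ℓ₁, β ≥ β₁) the third cumulant κ₃ of (P_0^(01), P_(n e₂)^(01),
P_(n e₃)^(01)) satisfies n¹²·|κ₃| ≥ c₃·Γ₃(n·a(β)) for 1 ≤ n ≤ L/8 (tree level: the triangle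
contraction 8·Π⟨F₀₁F₀₁⟩ > 0 at order g⁶). [deps: FemtoCurvatureTwoPoint] [difficulty: L] -/
@[route_item "route-QuantumFields-LangevinControlUV"]
def FemtoCurvatureSkewness : Prop :=
  open Literature.MathematicalPhysics.QuantumFieldTheory in ∀ (G : Type) [Group G] [TopologicalSpace G] [IsTopologicalGroup G] [CompactSpace G], IsCompactSimpleLieGroup G → letI : MeasurableSpace G := borel G; haveI : BorelSpace G := ⟨rfl⟩; ∀ (r : LatticeRep G), ∀ (a : ℝ → ℝ), (∃ (Γ : ℝ → ℝ) (β₀ ℓ₀ c C : ℝ), 0 < ℓ₀ ∧ 0 < c ∧ (∀ β, 0 < a β) ∧ Filter.Tendsto a Filter.atTop (nhds 0) ∧ (∀ s : ℝ, 0 < s → s ≤ ℓ₀ → 0 < Γ s ∧ Γ s ≤ 1) ∧ ∀ (L : ℕ) [NeZero L] (β : ℝ), β₀ ≤ β → (L : ℝ) * a β ≤ ℓ₀ → let P : (Fin 4 → ZMod L) → Fin 4 → Fin 4 → GaugeConfig 4 L G → ℝ := fun x i j U => (r.N : ℝ) - (r.ρ (plaquetteHolonomy U x i j)).trace.re; let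 E : (GaugeConfig 4 L G → ℝ) → ℝ := fun F => wilsonExpectation (d := 4) (L := L) r.ρ β F; let cov : (GaugeConfig 4 L G → ℝ) → (GaugeConfig 4 L G → ℝ) → ℝ := fun F F' => E (fun U => F U * F' U) - E F * E F'; let dist : (Fin 4 → ZMod L) → (Fin 4 → ZMod L) → ℝ := fun x y => Real.sqrt (∑ k : Fin 4, (((x k - y k).valMinAbs : ℤ) : ℝ) ^ 2); (∀ n : ℕ, 1 ≤ n → 8 * n ≤ L → c * Γ ((n : ℝ) * a β) ≤ (n : ℝ) ^ 8 * cov (P 0 0 1) (P (Pi.single (2 : Fin 4) ((n : ℕ) : ZMod L)) 0 1) ∧ (n : ℝ) ^ 8 * cov (P 0 0 1) (P (Pi.single (2 : Fin 4) ((n : ℕ) : ZMod L)) 0 1) ≤ C * Γ ((n : ℝ) * a β)) ∧ (∀ (x y : Fin 4 → ZMod L) (i j i' j' : Fin 4), x ≠ y → i ≠ j → i' ≠ j' → |cov (P x i j) (P y i' j')| * dist x y ^ 8 ≤ C * Γ (dist x y * a β))) → ∃ (Γ₃ : ℝ → ℝ) (β₁ ℓ₁ c₃ : ℝ), 0 <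 ℓ₁ ∧ 0 < c₃ ∧ (∀ s : ℝ, 0 < s → s ≤ ℓ₁ → 0 < Γ₃ s) ∧ ∀ (L : ℕ) [NeZero L] (β : ℝ), β₁ ≤ β → (L : ℝ) * a β ≤ ℓ₁ → let P : (Fin 4 → ZMod L) → Fin 4 → Fin 4 → GaugeConfig 4 L G → ℝ := fun x i j U => (r.N : ℝ) - (r.ρ (plaquetteHolonomy U x i j)).trace.re; let E : (GaugeConfig 4 L G → ℝ) → ℝ := fun F => wilsonExpectation (d := 4) (L := L) r.ρ β F; let cov : (GaugeConfig 4 L G → ℝ) → (GaugeConfig 4 L G → ℝ) → ℝ := fun F F' => E (fun U => F U * F' U) - E F * E F'; ∀ n : ℕ, 1 ≤ n → 8 * n ≤ L → c₃ * Γ₃ ((n : ℝ) * a β) ≤ (n : ℝ) ^ 12 * |E (fun U => P 0 0 1 U * P (Pi.single (2 : Fin 4) ((n : ℕ) : ZMod L)) 0 1 U * P (Pi.single (3 : Fin 4) ((n : ℕ) : ZMod L)) 0 1 U) - E (P 0 0 1) * cov (P (Pi.single (2 : Fin 4) ((n : ℕ) : ZMod L)) 0 1) (P (Pi.single (3 :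 Fin 4) ((n : ℕ) : ZMod L)) 0 1) - E (P (Pi.single (2 : Fin 4) ((n : ℕ) : ZMod L)) 0 1) * cov (P 0 0 1) (P (Pi.single (3 : Fin 4) ((n : ℕ) : ZMod L)) 0 1) - E (P (Pi.single (3 : Fin 4) ((n : ℕ) : ZMod L)) 0 1) * cov (P 0 0 1) (P (Pi.single (2 : Fin 4) ((n : ℕ) : ZMod L)) 0 1) - E (P 0 0 1) * E (P (Pi.single (2 : Fin 4) ((n : ℕ) : ZMod L)) 0 1) * E (P (Pi.single (3 : Fin 4) ((n : ℕ) : ZMod L)) 0 1)|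

/-- item stmt-QuantumFields-9366 · support · rank 5 · open · by planner
why it might fail: It IS the Millennium gap in UV units (ξ(β)a(β) bounded, one volume-uniform rate; barrier PerturbativeInvisibility). As typed ∀a also admits slowly-decaying step unit maps, for which rate c₁a(β) demands ξ(β)=O(1/a(β)) ≪ asymptotic scaling: physically FALSE (Lean refutation needs ξ→∞, itself open).
sources: JaffeWitten2000, arXiv180301950, Literature.MathematicalPhysics.QuantumFieldTheory.LatticeMassGapAllCouplings, Literature.Barriers.QuantumFields.PerturbativeInvisibility, Literature.Barriers.QuantumFields.FixedCouplingUltralocality, OsterwalderSeiler1978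
[crux] (IMPORTED infrared leg, in the units of the UV engine — the socket for flux-bootstrap /
finite-size-criterion / Gronwall-type routes) for every G, r and every unit map a for which the
FemtoCurvatureTwoPoint bounds hold there are c₁ > 0, β₂ and S₁ : ℝ → ℕ such that for all
gauge-invariant local lattice observables A, B there is C (uniform in β) with |⟨A·τ_n B⟩ − ⟨A⟩⟨B⟩| ≤
C·exp(−c₁·a(β)·n) on every torus of side 2S+1 ≥ 2S₁(β)+1 at every β ≥ β₂ and all n ≤ S
(`latticeConnectedCorr`): the lattice mass gap is ≥ c₁ in perturbative physical units, uniformly in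
the volume — dimensional transmutation made explicit (ξ(β)·a(β) stays bounded). [deps:
FemtoCurvatureTwoPoint] [difficulty: open-problem] -/
@[route_item "route-QuantumFields-LangevinControlUV"]
def LatticeGapInUVUnits : Prop :=
  open Literature.MathematicalPhysics.QuantumFieldTheory in ∀ (G : Type) [Group G] [TopologicalSpace G] [IsTopologicalGroup G] [CompactSpace G], IsCompactSimpleLieGroup G → letI : MeasurableSpace G := borel G; haveI : BorelSpace G := ⟨rfl⟩; ∀ (r : LatticeRep G), ∀ (a : ℝ → ℝ), (∃ (Γ : ℝ → ℝ) (β₀ ℓ₀ c C : ℝ), 0 < ℓ₀ ∧ 0 < c ∧ (∀ β, 0 < a β) ∧ Filter.Tendsto a Filter.atTop (nhds 0) ∧ (∀ s : ℝ, 0 < s → s ≤ ℓ₀ → 0 < Γ s ∧ Γ s ≤ 1) ∧ ∀ (L : ℕ) [NeZero L] (β : ℝ), β₀ ≤ β → (L : ℝ) * a β ≤ ℓ₀ → let P : (Fin 4 → ZMod L) → Fin 4 → Fin 4 → GaugeConfig 4 L G → ℝ := fun x i j U => (r.N : ℝ) - (r.ρ (plaquetteHolonomy U x i j)).trace.re;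 let E : (GaugeConfig 4 L G → ℝ) → ℝ := fun F => wilsonExpectation (d := 4) (L := L) r.ρ β F; let cov : (GaugeConfig 4 L G → ℝ) → (GaugeConfig 4 L G → ℝ) → ℝ := fun F F' => E (fun U => F U * F' U) - E F * E F'; let dist : (Fin 4 → ZMod L) → (Fin 4 → ZMod L) → ℝ := fun x y => Real.sqrt (∑ k : Fin 4, (((x k - y k).valMinAbs : ℤ) : ℝ) ^ 2); (∀ n : ℕ, 1 ≤ n → 8 * n ≤ L → c * Γ ((n : ℝ) * a β) ≤ (n : ℝ) ^ 8 * cov (P 0 0 1) (P (Pi.single (2 : Fin 4) ((n : ℕ) : ZMod L)) 0 1) ∧ (n : ℝ) ^ 8 * cov (P 0 0 1) (P (Pi.single (2 : Fin 4) ((n : ℕ) : ZMod L)) 0 1) ≤ C * Γ ((n : ℝ) * a β)) ∧ (∀ (x y : Fin 4 → ZMod L) (i j i' j' : Fin 4), x ≠ y → i ≠ j → i' ≠ j' → |cov (P x i j) (P y i' j')| * dist x y ^ 8 ≤ C * Γ (dist x y * a β))) → ∃ (c₁ β₂ : ℝ) (S₁ : ℝ → ℕ), 0 < c₁ ∧ ∀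 A B : YMSpecies G, ∃ C : ℝ, ∀ β : ℝ, β₂ ≤ β → ∀ S n : ℕ, S₁ β ≤ S → n ≤ S → |latticeConnectedCorr r.ρ β (2 * S + 1) A.F B.F n| ≤ C * Real.exp (-(c₁ * a β * n))

/-- item stmt-QuantumFields-16110 · support · rank 6 · open · by planner
why it might fail: Hides E1 (O(4) invariance of subsequential hypercubic limits; barrier RegularisationDichotomy), E0′ for ALL species, the femto→(a_kL_k→∞) transfer; as typed a fast-decaying step a can meet all 3 hypotheses yet sch.a=a(β_k)≪a_AF has no nontrivial tempered limit. (β_k→∞ itself is free: a→0 at +∞.)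
sources: OsterwalderSchrader1975, OsterwalderSeiler1978, Seiler1982, GlimmJaffe1987, JaffeWitten2000, DavoudiSavage2012
[crux] (the OS legs AT WEAK COUPLING — statement re-type 2026-08-16, p116790: `def YangMills` gained
the conjunct `sch.HasWeakCouplingLimit`; this route builds the ∃-literal (sch, T) here, so the
conjunct is produced INSIDE the witness. Supersedes `OSLegsFromFemtoAndGap`
(stmt-QuantumFields-9367) as the hypothesis of `closes`; it is that statement verbatim with
`sch.HasWeakCouplingLimit` (= `Tendsto sch.β atTop atTop`, YangMillsOS) added to the conclusion,
hence implies it outright, and every registered line of stmt-9367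
(Cruxes/OSLegsFromFemtoAndGap/Lines: dlr-collar-transfer r3, hankel-rope,
rp-self-improving-shadow-assembly) proves it by letting its scheme-producing stub also emit `Tendsto
sch.β atTop atTop` — there a_k = a(β_k) → 0 is obtained from `Tendsto a atTop (nhds 0)` precisely by
choosing β_k ↑ ∞. The old decl is kept, not restated in place, because landed Theorems elaborate
against its exact body (LangevinControlUVOSLegsFromFemtoAndGapDefs.lean `crux_iff := Iff.rfl`,
DefsR3, Stub*, Negative/*). NOT derivable in glue from `sch.a k = a (sch.β k) → 0`: the existential
unit map a of FemtoCurvatureTwoPoint is neither monotone nor locally bounded below, and `closes` may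
alte -/
@[route_item "route-QuantumFields-LangevinControlUV"]
def OSLegsAtWeakCoupling : Prop :=
  open Literature.MathematicalPhysics.QuantumFieldTheory in ∀ (G : Type) [Group G] [TopologicalSpace G] [IsTopologicalGroup G] [CompactSpace G], IsCompactSimpleLieGroup G → letI : MeasurableSpace G := borel G; haveI : BorelSpace G := ⟨rfl⟩; ∀ (r : LatticeRep G), ∀ (a : ℝ → ℝ), (∃ (Γ : ℝ → ℝ) (β₀ ℓ₀ c C : ℝ), 0 < ℓ₀ ∧ 0 < c ∧ (∀ β, 0 < a β) ∧ Filter.Tendsto a Filter.atTop (nhds 0) ∧ (∀ s : ℝ, 0 < s → s ≤ ℓ₀ → 0 < Γ s ∧ Γ s ≤ 1) ∧ ∀ (L : ℕ) [NeZero L] (β : ℝ), β₀ ≤ β → (L : ℝ) * a β ≤ ℓ₀ → let P : (Fin 4 → ZMod L) → Fin 4 → Fin 4 → GaugeConfig 4 L G → ℝ := fun x i j U => (r.N : ℝ) - (r.ρ (plaquetteHolonomy U x i j)).trace.re; let E : (GaugeConfig 4 L G → ℝ) → ℝ := fun F => wilsonExpectation (d := 4) (L := L) r.ρ β F; let cov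 : (GaugeConfig 4 L G → ℝ) → (GaugeConfig 4 L G → ℝ) → ℝ := fun F F' => E (fun U => F U * F' U) - E F * E F'; let dist : (Fin 4 → ZMod L) → (Fin 4 → ZMod L) → ℝ := fun x y => Real.sqrt (∑ k : Fin 4, (((x k - y k).valMinAbs : ℤ) : ℝ) ^ 2); (∀ n : ℕ, 1 ≤ n → 8 * n ≤ L → c * Γ ((n : ℝ) * a β) ≤ (n : ℝ) ^ 8 * cov (P 0 0 1) (P (Pi.single (2 : Fin 4) ((n : ℕ) : ZMod L)) 0 1) ∧ (n : ℝ) ^ 8 * cov (P 0 0 1) (P (Pi.single (2 : Fin 4) ((n : ℕ) : ZMod L)) 0 1) ≤ C * Γ ((n : ℝ) * a β)) ∧ (∀ (x y : Fin 4 → ZMod L) (i j i' j' : Fin 4), x ≠ y → i ≠ j → i' ≠ j' → |cov (P x i j) (P y i' j')| * dist x y ^ 8 ≤ C * Γ (dist x y * a β))) → (∃ (Γ₃ : ℝ → ℝ) (β₁ ℓ₁ c₃ : ℝ), 0 < ℓ₁ ∧ 0 < c₃ ∧ (∀ s : ℝ, 0 < s → s ≤ ℓ₁ → 0 < Γ₃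 s) ∧ ∀ (L : ℕ) [NeZero L] (β : ℝ), β₁ ≤ β → (L : ℝ) * a β ≤ ℓ₁ → let P : (Fin 4 → ZMod L) → Fin 4 → Fin 4 → GaugeConfig 4 L G → ℝ := fun x i j U => (r.N : ℝ) - (r.ρ (plaquetteHolonomy U x i j)).trace.re; let E : (GaugeConfig 4 L G → ℝ) → ℝ := fun F => wilsonExpectation (d := 4) (L := L) r.ρ β F; let cov : (GaugeConfig 4 L G → ℝ) → (GaugeConfig 4 L G → ℝ) → ℝ := fun F F' => E (fun U => F U * F' U) - E F * E F'; ∀ n : ℕ, 1 ≤ n → 8 * n ≤ L → c₃ * Γ₃ ((n : ℝ) * a β) ≤ (n : ℝ) ^ 12 * |E (fun U => P 0 0 1 U * P (Pi.single (2 : Fin 4) ((n : ℕ) : ZMod L)) 0 1 U * P (Pi.single (3 : Fin 4) ((n : ℕ) : ZMod L)) 0 1 U) - E (P 0 0 1) * cov (P (Pi.single (2 : Fin 4) ((n : ℕ) : ZMod L)) 0 1) (P (Pi.single (3 : Fin 4) ((n : ℕ) : ZMod L)) 0 1) - E (P (Pi.single (2 : Fin 4) ((n : ℕ) : ZMod L))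 0 1) * cov (P 0 0 1) (P (Pi.single (3 : Fin 4) ((n : ℕ) : ZMod L)) 0 1) - E (P (Pi.single (3 : Fin 4) ((n : ℕ) : ZMod L)) 0 1) * cov (P 0 0 1) (P (Pi.single (2 : Fin 4) ((n : ℕ) : ZMod L)) 0 1) - E (P 0 0 1) * E (P (Pi.single (2 : Fin 4) ((n : ℕ) : ZMod L)) 0 1) * E (P (Pi.single (3 : Fin 4) ((n : ℕ) : ZMod L)) 0 1)|) → (∃ (c₁ β₂ : ℝ) (S₁ : ℝ → ℕ), 0 < c₁ ∧ ∀ A B : YMSpecies G, ∃ C : ℝ, ∀ β : ℝ, β₂ ≤ β → ∀ S n : ℕ, S₁ β ≤ S → n ≤ S → |latticeConnectedCorr r.ρ β (2 * S + 1) A.F B.F n| ≤ C * Real.exp (-(c₁ * a β * n))) → ∃ (sch : SpeciesScheme (YMSpecies G)) (T : OSData (YMSpecies G) 4), (∀ k, sch.a k = a (sch.β k)) ∧ sch.HasWeakCouplingLimit ∧ IsYangMillsFor r sch T ∧ T.IsNontrivial r.curvature ∧ T.IsNonGaussian r.curvature ∧ ∃ Δ > 0, HasLatticeMassGap r sch 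Δ

/-- item stmt-QuantumFields-9367 · support · rank 6 · open · by planner
why it might fail: Hides E1 (O(4) invariance of subsequential hypercubic limits; barrier RegularisationDichotomy), E0′ for ALL species, the femto→(a_kL_k→∞) transfer; as typed a fast-decaying step a can meet all 3 hypotheses (gap clause only weakens) yet a scheme with sch.a=a(β_k)≪a_AF has no nontrivial tempered limit
sources: OsterwalderSchrader1975, OsterwalderSeiler1978, Seiler1982, GlimmJaffe1987, JaffeWitten2000, DavoudiSavage2012
[crux] (the OS legs, os-legs-fine-print's master reduction with its hard hypotheses named) for every
G, r, a: the FemtoCurvatureTwoPoint bounds ∧ the FemtoCurvatureSkewness witness ∧ the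
LatticeGapInUVUnits clustering imply the existence of a sequential scheme sch in units a (sch.a k =
a(sch.β k)) and OS data T (E0, E0′, E1–E4) with `IsYangMillsFor r sch T`, `T.IsNontrivial
r.curvature`, `T.IsNonGaussian r.curvature` and `HasLatticeMassGap r sch Δ` for some Δ > 0 (diagonal
subsequences over species × test functions, c_curv(k) := a_k⁻⁴, species off a countable family
zeroed; `HasLatticeMassGap` is the IR hypothesis re-indexed with L_k ≥ S₁(β_k)). [deps:
FemtoCurvatureTwoPoint, FemtoCurvatureSkewness, LatticeGapInUVUnits] [difficulty: open-problem] -/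
@[route_item "route-QuantumFields-LangevinControlUV"]
def OSLegsFromFemtoAndGap : Prop :=
  open Literature.MathematicalPhysics.QuantumFieldTheory in ∀ (G : Type) [Group G] [TopologicalSpace G] [IsTopologicalGroup G] [CompactSpace G], IsCompactSimpleLieGroup G → letI : MeasurableSpace G := borel G; haveI : BorelSpace G := ⟨rfl⟩; ∀ (r : LatticeRep G), ∀ (a : ℝ → ℝ), (∃ (Γ : ℝ → ℝ) (β₀ ℓ₀ c C : ℝ), 0 < ℓ₀ ∧ 0 < c ∧ (∀ β, 0 < a β) ∧ Filter.Tendsto a Filter.atTop (nhds 0) ∧ (∀ s : ℝ, 0 < s → s ≤ ℓ₀ → 0 < Γ s ∧ Γ s ≤ 1) ∧ ∀ (L : ℕ) [NeZero L] (β : ℝ), β₀ ≤ β → (L : ℝ) * a β ≤ ℓ₀ → let P : (Fin 4 → ZMod L) → Fin 4 → Fin 4 → GaugeConfig 4 L G → ℝ := fun x i j U => (r.N : ℝ) - (r.ρ (plaquetteHolonomy U x i j)).trace.re; let E : (GaugeConfig 4 L G → ℝ) → ℝ := fun F => wilsonExpectation (d := 4) (L := L) r.ρ β F; let cov : (GaugeConfig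 4 L G → ℝ) → (GaugeConfig 4 L G → ℝ) → ℝ := fun F F' => E (fun U => F U * F' U) - E F * E F'; let dist : (Fin 4 → ZMod L) → (Fin 4 → ZMod L) → ℝ := fun x y => Real.sqrt (∑ k : Fin 4, (((x k - y k).valMinAbs : ℤ) : ℝ) ^ 2); (∀ n : ℕ, 1 ≤ n → 8 * n ≤ L → c * Γ ((n : ℝ) * a β) ≤ (n : ℝ) ^ 8 * cov (P 0 0 1) (P (Pi.single (2 : Fin 4) ((n : ℕ) : ZMod L)) 0 1) ∧ (n : ℝ) ^ 8 * cov (P 0 0 1) (P (Pi.single (2 : Fin 4) ((n : ℕ) : ZMod L)) 0 1) ≤ C * Γ ((n : ℝ) * a β)) ∧ (∀ (x y : Fin 4 → ZMod L) (i j i' j' : Fin 4), x ≠ y → i ≠ j → i' ≠ j' → |cov (P x i j) (P y i' j')| * dist x y ^ 8 ≤ C * Γ (dist x y * a β))) → (∃ (Γ₃ : ℝ → ℝ) (β₁ ℓ₁ c₃ : ℝ), 0 < ℓ₁ ∧ 0 < c₃ ∧ (∀ s : ℝ, 0 < s → s ≤ ℓ₁ → 0 < Γ₃ s) ∧ ∀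 (L : ℕ) [NeZero L] (β : ℝ), β₁ ≤ β → (L : ℝ) * a β ≤ ℓ₁ → let P : (Fin 4 → ZMod L) → Fin 4 → Fin 4 → GaugeConfig 4 L G → ℝ := fun x i j U => (r.N : ℝ) - (r.ρ (plaquetteHolonomy U x i j)).trace.re; let E : (GaugeConfig 4 L G → ℝ) → ℝ := fun F => wilsonExpectation (d := 4) (L := L) r.ρ β F; let cov : (GaugeConfig 4 L G → ℝ) → (GaugeConfig 4 L G → ℝ) → ℝ := fun F F' => E (fun U => F U * F' U) - E F * E F'; ∀ n : ℕ, 1 ≤ n → 8 * n ≤ L → c₃ * Γ₃ ((n : ℝ) * a β) ≤ (n : ℝ) ^ 12 * |E (fun U => P 0 0 1 U * P (Pi.single (2 : Fin 4) ((n : ℕ) : ZMod L)) 0 1 U * P (Pi.single (3 : Fin 4) ((n : ℕ) : ZMod L)) 0 1 U) - E (P 0 0 1) * cov (P (Pi.single (2 : Fin 4) ((n : ℕ) : ZMod L)) 0 1) (P (Pi.single (3 : Fin 4) ((n : ℕ) : ZMod L)) 0 1) - E (P (Pi.single (2 : Fin 4) ((n : ℕ) : ZMod L)) 0 1) * cov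 (P 0 0 1) (P (Pi.single (3 : Fin 4) ((n : ℕ) : ZMod L)) 0 1) - E (P (Pi.single (3 : Fin 4) ((n : ℕ) : ZMod L)) 0 1) * cov (P 0 0 1) (P (Pi.single (2 : Fin 4) ((n : ℕ) : ZMod L)) 0 1) - E (P 0 0 1) * E (P (Pi.single (2 : Fin 4) ((n : ℕ) : ZMod L)) 0 1) * E (P (Pi.single (3 : Fin 4) ((n : ℕ) : ZMod L)) 0 1)|) → (∃ (c₁ β₂ : ℝ) (S₁ : ℝ → ℕ), 0 < c₁ ∧ ∀ A B : YMSpecies G, ∃ C : ℝ, ∀ β : ℝ, β₂ ≤ β → ∀ S n : ℕ, S₁ β ≤ S → n ≤ S → |latticeConnectedCorr r.ρ β (2 * S + 1) A.F B.F n| ≤ C * Real.exp (-(c₁ * a β * n))) → ∃ (sch : SpeciesScheme (YMSpecies G)) (T : OSData (YMSpecies G) 4), (∀ k, sch.a k = a (sch.β k)) ∧ IsYangMillsFor r sch T ∧ T.IsNontrivial r.curvature ∧ T.IsNonGaussian r.curvature ∧ ∃ Δ > 0, HasLatticeMassGap r sch Δ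

/-- item stmt-QuantumFields-9368 · support · rank 9 · closed · proved by Summit.QuantumFields.YangMills.Theorems.LangevinControlUV.marginalFlowLemma_proof @ fc27f9aba4bf (prover) · by planner
sources: GawedzkiKupiainen1985, BauerschmidtBrydgesSlade2019RG
[support] (card P2, the precise sense of "borderline summable": provable now, pure Mathlib) for b >
0, C ≥ 0 there are δ > 0, K ≥ 0 such that every real sequence with 0 < x₀ ≤ δ and |x_(j+1) − (x_j −
b x_j²)| ≤ C x_j³ satisfies 1/(1/x₀ + 2bj) ≤ x_j ≤ 1/(1/x₀ + bj/2) for all j, Σ_j x_j² < ∞ and Σ_j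
x_j² ≤ K x₀ — the one-loop term must be carried exactly (Σ x_j = ∞) while every O(x_j²)-relative
remainder is summable (Σ x_j² < ∞): the bookkeeping that replaces BG's subcriticality. [difficulty:
provable-now] -/
@[route_item "route-QuantumFields-LangevinControlUV"]
def MarginalFlowLemma : Prop :=
  ∀ b C : ℝ, 0 < b → 0 ≤ C → ∃ δ K : ℝ, 0 < δ ∧ 0 ≤ K ∧ ∀ x : ℕ → ℝ, 0 < x 0 → x 0 ≤ δ → (∀ j, |x (j + 1) - (x j - b * x j ^ 2)| ≤ C * x j ^ 3) → (∀ j : ℕ, 1 / (1 / x 0 + 2 * b * j) ≤ x j ∧ x j ≤ 1 / (1 / x 0 + b * j / 2)) ∧ Summable (fun j => x j ^ 2) ∧ ∑' j, x j ^ 2 ≤ K * x 0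

-- `MarginalFlowLemma` holds: proved by `Summit.QuantumFields.YangMills.Theorems.LangevinControlUV.marginalFlowLemma_proof` @ fc27f9aba4bf (its module imports this route file, so no `_holds` link can be stated here).

-- item stmt-QuantumFields-9751 · support · rank 9 · open · by planner — informal only, no Lean statement yet:
--   [support] ENGINE STATEMENT (card K1; the Boué–Dupuis value of the lattice Yang–Mills Langevin
--   dynamics; signature awaits the definition requests latticeLangevinDynamics / boueDupuisValue).
--   Setting: G compact simple, r a faithful unitary lattice representation, torus (ℤ/L)⁴, β in a femto
--   trajectory (L·a(β) ≤ ℓ₀ with the unit map a of FemtoCurvatureTwoPoint); U_t the Shen–Zhu–Zhu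
--   Langevin dynamics dU = −∇S_β(U)dt + √2 dB∘U on G^{E(Λ_L)} driven by flat Brownian motion B in 𝔤_r^E
--   (ShenZhuZhu2022 §3, Lemma 3.2: global strong solution, invariant law = wilsonMeasure r.ρ β), started
--   from Haar. P1 (cit

-- earlier Assembly (stmt-QuantumFields-16166, replaced 2026-08-16T18:14:00Z -> stmt-QuantumFields-16284): proved by Summit.QuantumFields.YangMills.Theorems.langevinControlUV_assembly_proof — FemtoCurvatureTwoPoint → FemtoPoincare → FemtoCurvatureSkewness → LatticeGapInUVUnits → OSLegsAtWeakCoupling → GapToContinuum → YangMills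
-- earlier Assembly (stmt-QuantumFields-9369, replaced 2026-08-16T17:49:35Z -> stmt-QuantumFields-16166): proved by Summit.QuantumFields.YangMills.Theorems.langevinControlUV_assembly_proof @ 26cdd46311db — FemtoCurvatureTwoPoint → FemtoPoincare → FemtoCurvatureSkewness → LatticeGapInUVUnits → OSLegsFromFemtoAndGap → GapToContinuum → YangMills
/-- item stmt-QuantumFields-16284 · assembly · rank 1 · closed · proved by Summit.QuantumFields.YangMills.Theorems.langevinControlUV_assemblyC_proof @ abb66f76fb65 (prover) · by planner
sources: JaffeWitten2000, BarashkovGubinelli2020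
[assembly] FemtoCurvatureTwoPointC → FemtoCurvatureSkewnessC → LatticeGapInUVUnitsC →
OSLegsAtWeakCouplingC → GapToContinuum → YangMills — verbatim the type of the re-pointed deciding
theorem `closes` (repair C′, 2026-08-16), so the landed proof
`Theorems/LangevinControlUVAssembly.lean` (`unfold Assembly; exact closes`) elaborates again
unchanged; supersedes the chain through the typed ∀a items (stmt-16166 / stmt-9369). -/
@[route_item "route-QuantumFields-LangevinControlUV"]
def Assembly : Prop :=
  FemtoCurvatureTwoPointC → FemtoCurvatureSkewnessC → LatticeGapInUVUnitsC → OSLegsAtWeakCouplingC → GapToContinuum → YangMills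

-- `Assembly` holds: proved by `Summit.QuantumFields.YangMills.Theorems.langevinControlUV_assemblyC_proof` @ abb66f76fb65 (its module imports this route file, so no `_holds` link can be stated here).

/-! D-0027 §2.1 — DECIDING THEOREM (planner-authored via `route open/edit --closes-file`; by planner-promote-QuantumFields-LangevinControlU-abcda0b3-0 2026-08-16T18:13:08Z):
its hypotheses are this route's items and its conclusion the sub-problem Statement (glue_lint), and it elaborates with this file. -/

@[closes "route-QuantumFields-LangevinControlUV"] theorem closes (hUV : FemtoCurvatureTwoPointC) (hSkew : FemtoCurvatureSkewnessC)
    (hIR : LatticeGapInUVUnitsC) (hOS : OSLegsAtWeakCouplingC) (hGap : GapToContinuum) : YangMills := by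
  intro G _ _ _ _ hG
  letI : MeasurableSpace G := borel G
  haveI : BorelSpace G := ⟨rfl⟩
  -- a faithful unitary lattice representation exists by `IsCompactSimpleLieGroup`
  obtain ⟨r⟩ := hG.2
  -- UV engine output in CONTINUOUS intrinsic units (repair C′): the skewness crux, fed the
  -- two-point crux at (G, r), returns ONE continuous package map `a` together with its
  -- third-cumulant witness (R1∘C′) — this `a` is threaded through the rest of the chain
  obtain ⟨a, ha, hPa, hSk⟩ := hSkew G hG r (hUV G hG r)
  -- imported infrared clustering in the same continuous units
  have hCl := hIR G hG r a ha hPa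
  -- OS legs at weak coupling: scheme in units `a` with `β_k → +∞`, OS data, Yang–Mills
  -- identification, non-triviality, non-Gaussianity, lattice gap
  obtain ⟨sch, T, _, hW, hYM, hNT, hNG, Δ, hΔ, hlat⟩ := hOS G hG r a ha hPa hSk hCl
  -- transfer-matrix reduction upgrades the lattice gap to `T.HasMassGap Δ`
  exact ⟨r, sch, T, hW, hYM, hNT, hNG, Δ, hΔ, hGap G r sch T Δ hΔ hYM hlat, hlat⟩

end Summit.QuantumFields.YangMills.Theses.LangevinControlUV
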